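import Literature.Probability.Percolation.TwoSetConditionalAssociationRC
import HarnessLib

/-!
# Covariances along the two-cluster Gibbs sampler of van den Berg–Häggström–Kahn (2006), §2.1, for the
# random-cluster measure `φ_{𝐩,q}`, `q ≥ 1`: the one-step covariance decomposition and the reduction of a
# conditional covariance sign to the sign of the averaged one-step ("within") covariances

Topic `Literature/Probability/Percolation`; the `q ≥ 1` companion of `TwoClusterGibbsCovariance.lean` (the same
statements at `q = 1`, product measure) built on the random-cluster two-block sampler of
`TwoSetConditionalAssociationRC.lean` (BHK §2.1 for `φ_{𝐩,q}`: point masses `BHK2006.rcMass`, deleted pairs =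
parameter `0` (`BHK2006.delW`, Lemma 2.3), the two half-steps as exact identities
`BHK2006.rc_set_sum_cond_cluster(')` (Lemma 2.4 summed), the chain `BHK2006.rcGibbsE`, its stationarity, the
comparison in `𝐩` (Grimmett Thm. (3.21), display (16)) and the Doeblin contraction `BHK2006.rcGibbsE_iterate_sub_le`).
ALL declarations are definitions with bodies or theorems (D-0014/D-0026: no named fact is introduced).

Written for the FK sub-lane of the `prim` cell's post-continuity programme (run/shared/lean/prim/bschramm/FK-Q2.md
§12.6(b),(d) and §12.7 items L-f/L-g: the marker-dominance lemma MDL(X)_FK and "Lemma T" of the conditioned slack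
hierarchy for `φ_{𝐩,q}`), whose `q = 1` versions in the tree (`…HullPortTANSetMarkerDominance`, `…HullPortCSHCellOne`,
`…CSHLemmaT`, `…CovTauAssembly`) consume exactly the `q = 1` forms of the three reduction theorems below.

## The mathematics (BHK's chain for `φ_{𝐩,q}`, read on functions of `C_S` only)

`φ = φ_{𝐩,q}` the (free) random-cluster measure with pair parameters `𝐩 = w ∈ [0,1]^{Sym2 V}` on a finite vertex
type (`rcMeasureW w q ∅`), vertex sets `S, T`, `D = {S ↮ T}`.  For a function `φ` of `C_S` put
`(A φ)(B) = E_{φ_{G − B̄_T, q}}[φ(C_S)]` (the `S`-half-step: the cluster of `S` under the random-cluster measure with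
the pairs meeting `T ∪ V(B)` deleted and the SAME `q` — by Lemmas 2.3–2.4 this is `E_φ[φ(C_S) | C_T = B]` on `D`) and
`(𝑇 φ)(C) = E_{φ_{G − C̄_S, q}}[(A φ)(C_T)]` (the `T`-half-step followed by the `S`-half-step; `𝑇` is the one-step
operator `BHK2006.rcGibbsE` on functions of the first coordinate, `BHK2006.rcGibbsE_comp_fst`).  With
`cov_D(φ, h) = φ(D)·E[φ h 1_D] − E[φ 1_D]·E[h 1_D]` and the averaged conditional ("within") covariance
`R(φ) = E[ (A(φh) − Aφ·Ah)(C_T) 1_D ]`, the two half-step identities give the exact ONE-STEP DECOMPOSITION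

  `cov_D(φ, h) = φ(D)·R(φ) + cov_D(𝑇φ, h)`        (`BHK2006.rcCovD_eq_withinD_add`),

hence `cov_D(φ,h) = φ(D) Σ_{k<n} R(𝑇ᵏφ) + cov_D(𝑇ⁿφ, h)`.  For `q ≥ 1`, `𝑇` preserves monotonicity (Remark 2.8:
`A φ` is DECREASING in `B` and `𝑇 φ` INCREASING in `C` for increasing `φ` — for `φ_{𝐩,q}` this is the comparison
inequality in `𝐩`, BHK's display (16), `BHK2006.sum_rcMass_mono_weights`) and nonnegativity, and contracts
oscillations by `1 − ε`, `ε = ∏_{e non-loop, e meets T} (1 − w e)` (the regeneration bound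
`BHK2006.rcGibbsE_iterate_sub_le`: for `q ≥ 1` every `T`-half-step law puts mass `≥ ε` on `{C_T = ∅}`), so
`|cov_D(𝑇ⁿφ, h)| ≤ 2 (1−ε)ⁿ osc(φ) ‖h‖_∞ → 0`.  THEOREM (`BHK2006.rcCovD_nonneg_of_withinD_nonneg`): if `q ≥ 1`, every
non-loop pair meeting `T` has `w e < 1` and `R(g) ≥ 0` for every monotone nonnegative `g`, then `cov_D(f, h) ≥ 0`
for every monotone `f`.  Measure-level forms for `rcMeasureW w q ∅`, `S = {s}`, `T = X`
(`BHK2006_clusterConditionalCov_nonneg_of_within_rc`; the "world" given the cluster of `X` in `ω` is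
`φ^ω = rcMeasureW (delW w A_X(ω)) q ∅`, `A_X(ω)` the pairs meeting the open vertex cluster of `X` — the
random-cluster measure on `G − C̄_X(ω)` with the same `q`, Lemma 2.3), the closure over degenerate parameters
(`…_of_forall_nondegenerate`: the hypothesis is only needed for parameters in `(0,1)`, for a test function `h_𝐩`
depending continuously on `𝐩`; both sides are continuous in `𝐩`, `BHK2006.continuous_rcMass`), the TWO-MARKER
form `h = a·1{s↔z} − b·1{s↔y}` (`BHK2006_twoMarkerCov_le_of_within_rc(…)`, the shape of the marker-dominance
lemma) and the MULTI-MARKER form `h = Σ_u c(u)·1{s↔u}` (`BHK2006_multiMarkerCov_nonneg_of_within_rc(…)`, the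
shape of "Lemma T" of the conditioned slack hierarchy).

Not in print in this form; it is BHK's proof scheme of Thm. 2.1 for the random-cluster measure ("It is clear
that `φ̂` is stationary for this chain … so to prove Theorem 2.1 it's enough to show Claim 2.5", pp. 10–11)
with the FKG inequality of Lemma 2.2 replaced by an abstract hypothesis on the one-step conditional
covariances, derived here exactly as at `q = 1` in `TwoClusterGibbsCovariance.lean`.
[cite: VandenbergHaggstromKahn2005, §2.1 pp. 9–13 (eq. (11), Lemmas 2.2–2.4, the chain, Claim 2.5, display (16), Remark 2.8)]
[cite: Grimmett2006, §1.4 eq. (1.20) (p. 15); Thm. (3.21), eq. (3.22) (comparison inequalities)]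

## References

* J. van den Berg, O. Häggström, J. Kahn, *Some conditional correlation inequalities for percolation and
  related processes*, Random Structures Algorithms 29 (2006) 417–435 (arXiv:math/0408176): §2.1, eq. (11),
  Thm. 2.1, Lemmas 2.2–2.4, Claim 2.5, Lemmas 2.6–2.7, display (16), Remark 2.8 (pp. 9–12).
* G. Grimmett, *The Random-Cluster Model*, Springer 2006: eq. (1.20) (p. 15), Thm. (3.8) (FKG),
  Thm. (3.21) eq. (3.22) (comparison inequalities).
-/

noncomputable section

open MeasureTheory unitInterval
open Literature.Probability.LatticeModels (rcMeasureW isProbabilityMeasure_rcMeasureW)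

namespace Literature.Probability.Percolation

namespace BHK2006

open scoped Classical
open DecisionTree (ind ind_of_mem ind_of_not_mem ind_nonneg)

section Sums

variable {V : Type*} [Fintype V] (w : Sym2 V → unitInterval) (q : ℝ) (S T : Set V)

/-! ### The half-step and one-step operators on functions of `C_S`, for `φ_{𝐩,q}` -/

/-- **`E_{φ_{G − B̄_T, q}}[φ(C_S)]`** (the `S`-half-step of BHK's chain for `φ_{𝐩,q}` applied to a function of
`C_S`): the expectation of `φ` of the cluster of `S` under the random-cluster measure with the pairs meeting
`T ∪ V(B)` deleted (parameter `0`) and the same `q`; on `{S ↮ T}` this is `E_φ[φ(C_S) | C_T = B]` (Lemmas 2.3–2.4).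
[cite: VandenbergHaggstromKahn2005, §2.1 Lemmas 2.3–2.4 (p. 10), p. 11 (`Pr(C_S^i = ·) = φ(C_S = · | C_T = C_T^i)`)] -/
def rcCondS (φ : Set (Sym2 V) → ℝ) (B : Set (Sym2 V)) : ℝ :=
  ∑ η, rcMass (delW w (barOf T B)) q η * φ (setCl η S)

/-- **BHK's one-step operator on functions of `C_S`, for `φ_{𝐩,q}`**: `(𝑇φ)(C) = E[ E[φ(C_S') | C_T'] | C_S = C]`
(resample `C_T` given `C_S = C` from `φ_{G − C̄_S, q}`, then `C_S` given the new `C_T`).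
[cite: VandenbergHaggstromKahn2005, §2.1 pp. 10–11 (definition of the chain)] -/
def rcGibbsT (φ : Set (Sym2 V) → ℝ) (A : Set (Sym2 V)) : ℝ :=
  ∑ η, rcMass (delW w (barOf S A)) q η * rcCondS w q S T φ (setCl η T)

/-- **Conditional covariance given `C_T = B`** of two functions of `C_S` (for `φ_{𝐩,q}`):
`E[φh | C_T = B] − E[φ | C_T = B] E[h | C_T = B]`, the expectations taken under `φ_{G − B̄_T, q}`.
[cite: VandenbergHaggstromKahn2005, §2.1 Lemma 2.4 (p. 10)] -/
def rcCondCov (φ h : Set (Sym2 V) → ℝ) (B : Set (Sym2 V)) : ℝ :=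
  rcCondS w q S T (fun A => φ A * h A) B - rcCondS w q S T φ B * rcCondS w q S T h B

/-- **The averaged one-step ("within") covariance** `R(φ) = E_φ[ Cov(φ(C_S), h(C_S) | C_T) 1_D ]`
(denominator-free: not divided by `φ(D)`). [cite: VandenbergHaggstromKahn2005, §2.1 pp. 10–11] -/
def rcWithinD (D : Set (Set (Sym2 V))) (φ h : Set (Sym2 V) → ℝ) : ℝ :=
  ∑ ω, rcMass w q ω * (rcCondCov w q S T φ h (setCl ω T) * ind D ω)

variable {T} in
/-- **Denominator-free conditional covariance on `D`** of two functions of `C_S` under `φ_{𝐩,q}`: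
`cov_D(φ, h) = φ(D)·E[φ(C_S) h(C_S) 1_D] − E[φ(C_S) 1_D]·E[h(C_S) 1_D]` (`= φ(D)² Cov(φ, h | D)`).
[cite: VandenbergHaggstromKahn2005, Thm. 2.1 eq. (12) (p. 9); Thm. 1.5 eq. (9) (p. 7)] -/
def rcCovD (D : Set (Set (Sym2 V))) (φ h : Set (Sym2 V) → ℝ) : ℝ :=
  (∑ ω, rcMass w q ω * ind D ω) * (∑ ω, rcMass w q ω * (φ (setCl ω S) * h (setCl ω S) * ind D ω)) -
    (∑ ω, rcMass w q ω * (φ (setCl ω S) * ind D ω)) * (∑ ω, rcMass w q ω * (h (setCl ω S) * ind D ω))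

/-- `𝑇` is BHK's one-step operator `rcGibbsE` restricted to functions of the first coordinate `C_S`.
[cite: VandenbergHaggstromKahn2005, §2.1 pp. 10–11] -/
theorem rcGibbsE_comp_fst (φ : Set (Sym2 V) → ℝ) :
    rcGibbsE w q S T (φ ∘ Prod.fst) = rcGibbsT w q S T φ ∘ Prod.fst := by
  funext x
  rfl

/-- Iterates: `rcGibbsEⁿ (φ ∘ fst) = (𝑇ⁿ φ) ∘ fst`. [cite: VandenbergHaggstromKahn2005, §2.1 pp. 10–11] -/
theorem rcGibbsE_iterate_comp_fst (n : ℕ) (φ : Set (Sym2 V) → ℝ) :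
    (rcGibbsE w q S T)^[n] (φ ∘ Prod.fst) = (rcGibbsT w q S T)^[n] φ ∘ Prod.fst := by
  induction n generalizing φ with
  | zero => rfl
  | succ n ih =>
    rw [Function.iterate_succ_apply, Function.iterate_succ_apply, rcGibbsE_comp_fst, ih]

/-! ### Monotonicity, positivity and contraction of the operators (`q ≥ 1`) -/

variable {w q}

/-- `E[φ(C_S) | C_T = B]` is DECREASING in `B` for increasing `φ` and `q ≥ 1`: a larger `B` deletes more pairs,
which makes the fresh random-cluster configuration stochastically smaller (the comparison inequality in `𝐩`,
BHK's display (16); Remark 2.8). [cite: VandenbergHaggstromKahn2005, §2.1 display (16) and Remark 2.8 (p. 12); Grimmett2006, Thm. (3.21)] -/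
theorem rcCondS_antitone (hq : 1 ≤ q) {φ : Set (Sym2 V) → ℝ} (hφ : Monotone φ) :
    Antitone (rcCondS w q S T φ) := by
  intro B B' hBB'
  unfold rcCondS
  exact sum_rcMass_mono_weights (fun e => delW_anti w (barOf_mono T hBB') e) hq
    fun η η' hηη' => hφ (setCl_mono hηη' S)

/-- `E[φ(C_S) | C_T = B] ≥ 0` for `φ ≥ 0` (`q > 0`). [folklore] -/
private theorem rcCondS_nonneg (hq : 0 < q) {φ : Set (Sym2 V) → ℝ} (hφ0 : ∀ A, 0 ≤ φ A)
    (B : Set (Sym2 V)) : 0 ≤ rcCondS w q S T φ B :=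
  Finset.sum_nonneg fun η _ => mul_nonneg (rcMass_nonneg _ hq η) (hφ0 _)

/-- **`𝑇` preserves monotonicity** (`q ≥ 1`; the new `C_S` is increasing in the old one: a larger `C_S` deletes
more pairs for the `T`-half-step, the new `C_T` is stochastically smaller, and `E[φ(C_S) | C_T]` is decreasing
in `C_T`). [cite: VandenbergHaggstromKahn2005, §2.1 display (16) and Remark 2.8 (p. 12); Grimmett2006, Thm. (3.21)] -/
theorem rcGibbsT_mono (hq : 1 ≤ q) {φ : Set (Sym2 V) → ℝ} (hφ : Monotone φ) :
    Monotone (rcGibbsT w q S T φ) := by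
  intro A A' hAA'
  unfold rcGibbsT
  exact sum_rcMass_anti_weights (fun e => delW_anti w (barOf_mono S hAA') e) hq
    fun η η' hηη' => rcCondS_antitone S T hq hφ (setCl_mono hηη' T)

/-- `𝑇` preserves nonnegativity (`q > 0`). [folklore] -/
private theorem rcGibbsT_nonneg (hq : 0 < q) {φ : Set (Sym2 V) → ℝ} (hφ0 : ∀ A, 0 ≤ φ A)
    (A : Set (Sym2 V)) : 0 ≤ rcGibbsT w q S T φ A :=
  Finset.sum_nonneg fun η _ => mul_nonneg (rcMass_nonneg _ hq η) (rcCondS_nonneg S T hq hφ0 _)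

/-- The iterates `𝑇ⁿ φ` of a monotone nonnegative `φ` are monotone and nonnegative (`q ≥ 1`).
[cite: VandenbergHaggstromKahn2005, §2.1 Remark 2.8 (p. 12)] -/
theorem rcGibbsT_iterate_mono_nonneg (hq : 1 ≤ q) {φ : Set (Sym2 V) → ℝ} (hφ : Monotone φ)
    (hφ0 : ∀ A, 0 ≤ φ A) (n : ℕ) :
    Monotone ((rcGibbsT w q S T)^[n] φ) ∧ ∀ A, 0 ≤ (rcGibbsT w q S T)^[n] φ A := by
  have hq0 : 0 < q := one_pos.trans_le hq
  induction n with
  | zero => exact ⟨hφ, hφ0⟩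
  | succ n ih =>
    rw [Function.iterate_succ_apply']
    exact ⟨rcGibbsT_mono S T hq ih.1, rcGibbsT_nonneg S T hq0 ih.2⟩

/-- **Regeneration contraction for `𝑇`** (`q ≥ 1`): `osc(𝑇ⁿ φ) ≤ (1 − ε)ⁿ osc(φ)`,
`ε = ∏_{e non-loop, e meets T} (1 − w e)` (from `rcGibbsE_iterate_sub_le`). [folklore] (Doeblin coupling)
[cite: VandenbergHaggstromKahn2005, §2.1 p. 11 (convergence of the chain)] -/
theorem rcGibbsT_iterate_sub_le (hq : 1 ≤ q) (n : ℕ) {φ : Set (Sym2 V) → ℝ} {c : ℝ}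
    (hφ : ∀ A A', φ A - φ A' ≤ c) (A A' : Set (Sym2 V)) :
    (rcGibbsT w q S T)^[n] φ A - (rcGibbsT w q S T)^[n] φ A' ≤
      (1 - regenWeight (fun e => (w e : ℝ)) T) ^ n * c := by
  have h := rcGibbsE_iterate_sub_le (w := w) (q := q) (S := S) (T := T) hq n (Φ := φ ∘ Prod.fst)
    (c := c) (fun x y => hφ x.1 y.1) (A, ∅) (A', ∅)
  rwa [rcGibbsE_iterate_comp_fst] at h

/-! ### The one-step covariance decomposition and its telescoped form -/

variable (w q)

/-- **One-step covariance decomposition along BHK's chain for `φ_{𝐩,q}`** (law of total covariance along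
`σ(C_T)`, then Lemma 2.4 for the `T`-half-step): for any functions `φ, h` of `C_S` and `q > 0`,
`cov_D(φ, h) = φ(D) · R(φ) + cov_D(𝑇φ, h)` — an exact identity.
[cite: VandenbergHaggstromKahn2005, §2.1 Lemmas 2.3–2.4 (p. 10) and pp. 10–11 (the chain; "φ̂ is stationary") — corollary, derived here] -/
theorem rcCovD_eq_withinD_add (hq : 0 < q) {D : Set (Set (Sym2 V))}
    (hD : ∀ ω, ω ∈ D ↔ ∀ s ∈ S, ∀ t ∈ T, ¬ (openGraph ω).Reachable s t) (φ h : Set (Sym2 V) → ℝ) :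
    rcCovD w q S D φ h =
      (∑ ω, rcMass w q ω * ind D ω) * rcWithinD w q S T D φ h + rcCovD w q S D (rcGibbsT w q S T φ) h := by
  -- (e1)–(e3): `E[ψ(C_S) 1_D] = E[(Aψ)(C_T) 1_D]` for `ψ = φh, φ, h`
  have e1 : ∑ ω, rcMass w q ω * (φ (setCl ω S) * h (setCl ω S) * ind D ω) =
      ∑ ω, rcMass w q ω * (rcCondS w q S T (fun A => φ A * h A) (setCl ω T) * ind D ω) :=
    rc_set_sum_cond_cluster' w hq S T (fun A _ => φ A * h A) hD
  have e2 : ∑ ω, rcMass w q ω * (φ (setCl ω S) * ind D ω) =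
      ∑ ω, rcMass w q ω * (rcCondS w q S T φ (setCl ω T) * ind D ω) :=
    rc_set_sum_cond_cluster' w hq S T (fun A _ => φ A) hD
  have e3 : ∑ ω, rcMass w q ω * (h (setCl ω S) * ind D ω) =
      ∑ ω, rcMass w q ω * (rcCondS w q S T h (setCl ω T) * ind D ω) :=
    rc_set_sum_cond_cluster' w hq S T (fun A _ => h A) hD
  -- (e4): `E[(𝑇φ)(C_S) h(C_S) 1_D] = E[(Aφ)(C_T) h(C_S) 1_D]` (the `T`-half-step)
  have e4 : ∑ ω, rcMass w q ω * (rcGibbsT w q S T φ (setCl ω S) * h (setCl ω S) * ind D ω) =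
      ∑ ω, rcMass w q ω * (rcCondS w q S T φ (setCl ω T) * h (setCl ω S) * ind D ω) := by
    rw [rc_set_sum_cond_cluster w hq S T (fun A B => rcCondS w q S T φ B * h A) hD]
    refine Finset.sum_congr rfl fun ω _ => ?_
    simp only [rcGibbsT, Finset.sum_mul, mul_assoc]
  -- (e5): `E[(Aφ)(C_T) h(C_S) 1_D] = E[(Aφ)(C_T) (Ah)(C_T) 1_D]` (the `S`-half-step)
  have e5 : ∑ ω, rcMass w q ω * (rcCondS w q S T φ (setCl ω T) * h (setCl ω S) * ind D ω) =
      ∑ ω, rcMass w q ω *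
        (rcCondS w q S T φ (setCl ω T) * rcCondS w q S T h (setCl ω T) * ind D ω) := by
    rw [rc_set_sum_cond_cluster' w hq S T (fun A B => rcCondS w q S T φ B * h A) hD]
    refine Finset.sum_congr rfl fun ω _ => ?_
    congr 1
    congr 1
    have hc : rcCondS w q S T h (setCl ω T) =
        ∑ η, rcMass (delW w (barOf T (setCl ω T))) q η * h (setCl η S) := rfl
    rw [hc, Finset.mul_sum]
    refine Finset.sum_congr rfl fun η _ => ?_
    ring
  -- (e6): `E[(𝑇φ)(C_S) 1_D] = E[(Aφ)(C_T) 1_D]`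
  have e6 : ∑ ω, rcMass w q ω * (rcGibbsT w q S T φ (setCl ω S) * ind D ω) =
      ∑ ω, rcMass w q ω * (rcCondS w q S T φ (setCl ω T) * ind D ω) :=
    (rc_set_sum_cond_cluster w hq S T (fun _ B => rcCondS w q S T φ B) hD).symm
  -- the within part as a difference
  have hW : rcWithinD w q S T D φ h =
      (∑ ω, rcMass w q ω * (rcCondS w q S T (fun A => φ A * h A) (setCl ω T) * ind D ω)) -
        ∑ ω, rcMass w q ω *
          (rcCondS w q S T φ (setCl ω T) * rcCondS w q S T h (setCl ω T) * ind D ω) := by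
    rw [rcWithinD, ← Finset.sum_sub_distrib]
    exact Finset.sum_congr rfl fun ω _ => by rw [rcCondCov]; ring
  rw [rcCovD, rcCovD, e1, e2, e3, e4, e5, e6, hW]
  ring

/-- **Telescoped form**: `cov_D(φ, h) = φ(D) Σ_{k<n} R(𝑇ᵏφ) + cov_D(𝑇ⁿφ, h)` for every `n` (`q > 0`).
[cite: VandenbergHaggstromKahn2005, §2.1 pp. 10–11 — corollary, derived here] -/
theorem rcCovD_eq_sum_withinD_add (hq : 0 < q) {D : Set (Set (Sym2 V))}
    (hD : ∀ ω, ω ∈ D ↔ ∀ s ∈ S, ∀ t ∈ T, ¬ (openGraph ω).Reachable s t) (φ h : Set (Sym2 V) → ℝ)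
    (n : ℕ) :
    rcCovD w q S D φ h = (∑ ω, rcMass w q ω * ind D ω) *
        ∑ k ∈ Finset.range n, rcWithinD w q S T D ((rcGibbsT w q S T)^[k] φ) h +
      rcCovD w q S D ((rcGibbsT w q S T)^[n] φ) h := by
  induction n with
  | zero => simp
  | succ n ih =>
    rw [Finset.sum_range_succ, mul_add, Function.iterate_succ_apply', ih,
      rcCovD_eq_withinD_add w q S T hq hD ((rcGibbsT w q S T)^[n] φ) h]
    ring

/-! ### Two elementary properties of `cov_D` -/

variable {w q}

/-- `cov_D` is unchanged when a constant is subtracted from the first function. [folklore] -/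
private theorem rcCovD_sub_const (D : Set (Set (Sym2 V))) (φ h : Set (Sym2 V) → ℝ) (c : ℝ) :
    rcCovD w q S D (fun A => φ A - c) h = rcCovD w q S D φ h := by
  have h1 : ∀ ω : Set (Sym2 V), rcMass w q ω * ((φ (setCl ω S) - c) * h (setCl ω S) * ind D ω) =
      rcMass w q ω * (φ (setCl ω S) * h (setCl ω S) * ind D ω) -
        c * (rcMass w q ω * (h (setCl ω S) * ind D ω)) := fun ω => by ring
  have h2 : ∀ ω : Set (Sym2 V), rcMass w q ω * ((φ (setCl ω S) - c) * ind D ω) =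
      rcMass w q ω * (φ (setCl ω S) * ind D ω) - c * (rcMass w q ω * ind D ω) := fun ω => by ring
  simp only [rcCovD, h1, h2, Finset.sum_sub_distrib, ← Finset.mul_sum]
  ring

/-- `|E[g 1_D]| ≤ c · φ(D)` when `|g| ≤ c` on the configurations (`q > 0`). [folklore] -/
private theorem abs_sum_rcMass_ind_le (hq : 0 < q) (D : Set (Set (Sym2 V))) {g : Set (Sym2 V) → ℝ}
    {c : ℝ} (hg : ∀ ω, |g ω| ≤ c) :
    |∑ ω, rcMass w q ω * (g ω * ind D ω)| ≤ c * ∑ ω, rcMass w q ω * ind D ω := by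
  calc |∑ ω, rcMass w q ω * (g ω * ind D ω)| ≤ ∑ ω, |rcMass w q ω * (g ω * ind D ω)| :=
        Finset.abs_sum_le_sum_abs _ _
    _ ≤ ∑ ω, c * (rcMass w q ω * ind D ω) := Finset.sum_le_sum fun ω _ => by
        rw [abs_mul, abs_mul, abs_of_nonneg (rcMass_nonneg w hq ω), abs_of_nonneg (ind_nonneg D ω)]
        calc rcMass w q ω * (|g ω| * ind D ω) ≤ rcMass w q ω * (c * ind D ω) :=
              mul_le_mul_of_nonneg_left (mul_le_mul_of_nonneg_right (hg ω) (ind_nonneg D ω))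
                (rcMass_nonneg w hq ω)
          _ = c * (rcMass w q ω * ind D ω) := by ring
    _ = c * ∑ ω, rcMass w q ω * ind D ω := by rw [Finset.mul_sum]

/-- **Small oscillation ⟹ small covariance**: if `φ A − φ A' ≤ δ` for all `A, A'` and `|h| ≤ M`, then
`|cov_D(φ, h)| ≤ 2 δ M` (`q > 0`). [folklore] -/
private theorem abs_rcCovD_le (hq : 0 < q) (D : Set (Set (Sym2 V))) {φ h : Set (Sym2 V) → ℝ}
    {δ M : ℝ} (hφ : ∀ A A', φ A - φ A' ≤ δ) (hM : ∀ A, |h A| ≤ M) :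
    |rcCovD w q S D φ h| ≤ 2 * δ * M := by
  have hδ : 0 ≤ δ := by simpa using hφ ∅ ∅
  have hM0 : 0 ≤ M := (abs_nonneg _).trans (hM ∅)
  set mD : ℝ := ∑ ω, rcMass w q ω * ind D ω with hmD
  have hmD0 : 0 ≤ mD := Finset.sum_nonneg fun ω _ => mul_nonneg (rcMass_nonneg w hq ω) (ind_nonneg D ω)
  have hmD1 : mD ≤ 1 := by
    calc mD ≤ ∑ ω, rcMass w q ω := Finset.sum_le_sum fun ω _ => by
            simpa using mul_le_mul_of_nonneg_left (ind_le_one D ω) (rcMass_nonneg w hq ω)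
      _ = 1 := sum_rcMass w hq
  rw [← rcCovD_sub_const S D φ h (φ ∅)]
  set ψ : Set (Sym2 V) → ℝ := fun A => φ A - φ ∅ with hψ
  have hψb : ∀ A, |ψ A| ≤ δ := fun A => abs_sub_le_iff.2 ⟨hφ A ∅, by linarith [hφ ∅ A]⟩
  have b1 : |∑ ω, rcMass w q ω * (ψ (setCl ω S) * h (setCl ω S) * ind D ω)| ≤ δ * M * mD := by
    have := abs_sum_rcMass_ind_le (w := w) hq D (g := fun ω => ψ (setCl ω S) * h (setCl ω S))
      (c := δ * M) (fun ω => by rw [abs_mul]; exact mul_le_mul (hψb _) (hM _) (abs_nonneg _) hδ)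
    simpa only [hmD] using this
  have b2 : |∑ ω, rcMass w q ω * (ψ (setCl ω S) * ind D ω)| ≤ δ * mD :=
    abs_sum_rcMass_ind_le hq D (g := fun ω => ψ (setCl ω S)) (fun ω => hψb _)
  have b3 : |∑ ω, rcMass w q ω * (h (setCl ω S) * ind D ω)| ≤ M * mD :=
    abs_sum_rcMass_ind_le hq D (g := fun ω => h (setCl ω S)) (fun ω => hM _)
  have hcov : rcCovD w q S D ψ h =
      mD * (∑ ω, rcMass w q ω * (ψ (setCl ω S) * h (setCl ω S) * ind D ω)) -
        (∑ ω, rcMass w q ω * (ψ (setCl ω S) * ind D ω)) *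
          (∑ ω, rcMass w q ω * (h (setCl ω S) * ind D ω)) := rfl
  rw [hcov]
  have t1 : |mD * ∑ ω, rcMass w q ω * (ψ (setCl ω S) * h (setCl ω S) * ind D ω)| ≤ δ * M := by
    rw [abs_mul, abs_of_nonneg hmD0]
    calc mD * |∑ ω, rcMass w q ω * (ψ (setCl ω S) * h (setCl ω S) * ind D ω)| ≤ 1 * (δ * M * mD) :=
          mul_le_mul hmD1 b1 (abs_nonneg _) zero_le_one
      _ ≤ δ * M := by rw [one_mul]; exact mul_le_of_le_one_right (mul_nonneg hδ hM0) hmD1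
  have t2 : |(∑ ω, rcMass w q ω * (ψ (setCl ω S) * ind D ω)) *
      (∑ ω, rcMass w q ω * (h (setCl ω S) * ind D ω))| ≤ δ * M := by
    rw [abs_mul]
    calc |∑ ω, rcMass w q ω * (ψ (setCl ω S) * ind D ω)| *
          |∑ ω, rcMass w q ω * (h (setCl ω S) * ind D ω)|
        ≤ (δ * mD) * (M * mD) := mul_le_mul b2 b3 (abs_nonneg _) (by positivity)
      _ ≤ δ * M := by nlinarith [mul_nonneg hδ hM0, mul_le_one₀ hmD1 hmD0 hmD1]
  calc |mD * (∑ ω, rcMass w q ω * (ψ (setCl ω S) * h (setCl ω S) * ind D ω)) -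
        (∑ ω, rcMass w q ω * (ψ (setCl ω S) * ind D ω)) *
          (∑ ω, rcMass w q ω * (h (setCl ω S) * ind D ω))|
      ≤ |mD * ∑ ω, rcMass w q ω * (ψ (setCl ω S) * h (setCl ω S) * ind D ω)| +
          |(∑ ω, rcMass w q ω * (ψ (setCl ω S) * ind D ω)) *
            (∑ ω, rcMass w q ω * (h (setCl ω S) * ind D ω))| := abs_sub _ _
    _ ≤ 2 * δ * M := by linarith

/-- `ε = ∏_{e non-loop, e meets T} (1 − w e) ≤ 1` (a product of numbers in `[0,1]`). [folklore] -/
private theorem regenWeight_coe_le_one (T : Set V) : regenWeight (fun e => (w e : ℝ)) T ≤ 1 := by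
  rw [regenWeight_eq_prod w T]
  exact Finset.prod_le_one (fun e _ => sub_nonneg.2 (w e).2.2)
    fun e _ => sub_le_self _ (w e).2.1

/-! ### The reduction theorem -/

/-- **Reduction of a conditional covariance sign to the averaged one-step covariances, for `φ_{𝐩,q}`,
`q ≥ 1`.**  Random-cluster measure with pair parameters `w ∈ [0,1]^{Sym2 V}` on a finite vertex type such that
every non-loop pair meeting `T` has `w e < 1` (positive regeneration weight `ε`); `D = {S ↮ T}`; `h` ANY function
of `C_S`.  If `R(g) = E[Cov(g(C_S), h(C_S) | C_T); D] ≥ 0` for every monotone nonnegative `g` (the conditional law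
given `C_T = B` on `D` being `φ_{G − B̄_T, q}`, Lemmas 2.3–2.4), then
`cov_D(f, h) = φ(D)E[f h 1_D] − E[f 1_D]E[h 1_D] ≥ 0` for every monotone `f`.
Proof: `cov_D(f,h) = cov_D(f − f(∅), h) = φ(D) Σ_{k<n} R(𝑇ᵏ(f − f ∅)) + cov_D(𝑇ⁿ(f − f ∅), h)`, the sum is
`≥ 0` (the iterates are monotone and nonnegative, `q ≥ 1`) and the last term is `O((1−ε)ⁿ)`.
[cite: VandenbergHaggstromKahn2005, §2.1 pp. 10–13 (the chain, Claim 2.5, display (16), Remark 2.8) — corollary, derived here] -/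
theorem rcCovD_nonneg_of_withinD_nonneg (hq : 1 ≤ q) {D : Set (Set (Sym2 V))}
    (hD : ∀ ω, ω ∈ D ↔ ∀ s ∈ S, ∀ t ∈ T, ¬ (openGraph ω).Reachable s t)
    (hε : 0 < regenWeight (fun e => (w e : ℝ)) T) (h : Set (Sym2 V) → ℝ)
    (hR : ∀ g : Set (Sym2 V) → ℝ, Monotone g → (∀ A, 0 ≤ g A) → 0 ≤ rcWithinD w q S T D g h)
    {f : Set (Sym2 V) → ℝ} (hf : Monotone f) : 0 ≤ rcCovD w q S D f h := by
  have hq0 : 0 < q := one_pos.trans_le hq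
  set f₀ : Set (Sym2 V) → ℝ := fun A => f A - f ∅ with hf₀
  have hf₀m : Monotone f₀ := fun A A' hAA' => sub_le_sub_right (hf hAA') _
  have hf₀0 : ∀ A, 0 ≤ f₀ A := fun A => sub_nonneg.2 (hf (Set.empty_subset A))
  set c : ℝ := f Set.univ - f ∅ with hc
  have hosc : ∀ A A', f₀ A - f₀ A' ≤ c := fun A A' => by
    simp only [hf₀, hc]
    linarith [hf (Set.subset_univ A), hf (Set.empty_subset A')]
  set M : ℝ := ∑ A : Set (Sym2 V), |h A| with hMdef
  have hM : ∀ A, |h A| ≤ M := fun A =>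
    Finset.single_le_sum (f := fun A => |h A|) (fun _ _ => abs_nonneg _) (Finset.mem_univ A)
  set mD : ℝ := ∑ ω, rcMass w q ω * ind D ω with hmD
  have hmD0 : 0 ≤ mD := Finset.sum_nonneg fun ω _ => mul_nonneg (rcMass_nonneg w hq0 ω) (ind_nonneg D ω)
  set ρ : ℝ := 1 - regenWeight (fun e => (w e : ℝ)) T with hρ
  have hρ0 : 0 ≤ ρ := sub_nonneg.2 (regenWeight_coe_le_one (w := w) T)
  have hρ1 : ρ < 1 := by simp only [hρ]; linarith
  -- the lower bound for every `n`
  have key : ∀ n : ℕ, -(2 * (ρ ^ n * c) * M) ≤ rcCovD w q S D f₀ h := by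
    intro n
    rw [rcCovD_eq_sum_withinD_add w q S T hq0 hD f₀ h n]
    have h1 : 0 ≤ mD * ∑ k ∈ Finset.range n, rcWithinD w q S T D ((rcGibbsT w q S T)^[k] f₀) h :=
      mul_nonneg hmD0 (Finset.sum_nonneg fun k _ =>
        hR _ (rcGibbsT_iterate_mono_nonneg S T hq hf₀m hf₀0 k).1
          (rcGibbsT_iterate_mono_nonneg S T hq hf₀m hf₀0 k).2)
    have h2 : |rcCovD w q S D ((rcGibbsT w q S T)^[n] f₀) h| ≤ 2 * (ρ ^ n * c) * M :=
      abs_rcCovD_le S hq0 D (rcGibbsT_iterate_sub_le S T hq n hosc) hM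
    linarith [neg_abs_le (rcCovD w q S D ((rcGibbsT w q S T)^[n] f₀) h)]
  -- let `n → ∞`
  have hlim : Filter.Tendsto (fun n : ℕ => -(2 * (ρ ^ n * c) * M)) Filter.atTop (nhds 0) := by
    have h0 : Filter.Tendsto (fun n : ℕ => ρ ^ n) Filter.atTop (nhds 0) :=
      tendsto_pow_atTop_nhds_zero_of_lt_one hρ0 hρ1
    have : Filter.Tendsto (fun n : ℕ => -(2 * (ρ ^ n * c) * M)) Filter.atTop
        (nhds (-(2 * (0 * c) * M))) :=
      (((h0.mul_const c).const_mul 2).mul_const M).neg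
    simpa using this
  have hge : 0 ≤ rcCovD w q S D f₀ h := le_of_tendsto' hlim key
  rwa [hf₀, rcCovD_sub_const] at hge

/-- The regeneration weight of a NON-DEGENERATE parameter vector is positive. [folklore] -/
private theorem regenWeight_pos_of_lt_one {p : Sym2 V → unitInterval}
    (hp : ∀ e : Sym2 V, ¬ e.IsDiag → (∃ v ∈ e, v ∈ T) → (p e : ℝ) < 1) :
    0 < regenWeight (fun e => (p e : ℝ)) T := by
  rw [regenWeight_eq_prod p T]
  refine Finset.prod_pos fun e he => ?_
  obtain ⟨hd, hv⟩ := (Finset.mem_filter.1 he).2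
  exact sub_pos.2 (hp e hd hv)

/-- `cov_D(f, h_𝐩)` is a continuous function of the parameter vector `𝐩` when the test function `h_𝐩` is
(`q > 0`; the point masses are continuous in `𝐩`). [cite: Grimmett2006, §4.5 proof of Thm. (4.58) (continuity in `p`)] -/
theorem continuous_rcCovD (hq : 0 < q) (D : Set (Set (Sym2 V))) (f : Set (Sym2 V) → ℝ)
    {h : (Sym2 V → unitInterval) → Set (Sym2 V) → ℝ} (hcont : ∀ C, Continuous fun p => h p C) :
    Continuous fun p : Sym2 V → unitInterval => rcCovD p q S D f (h p) := by
  unfold rcCovD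
  refine Continuous.sub (Continuous.mul ?_ ?_) (Continuous.mul ?_ ?_)
  · exact continuous_finsetSum _ fun ω _ => (continuous_rcMass hq ω).mul continuous_const
  · exact continuous_finsetSum _ fun ω _ => (continuous_rcMass hq ω).mul
      ((continuous_const.mul (hcont _)).mul continuous_const)
  · exact continuous_finsetSum _ fun ω _ => (continuous_rcMass hq ω).mul continuous_const
  · exact continuous_finsetSum _ fun ω _ => (continuous_rcMass hq ω).mul
      ((hcont _).mul continuous_const)

/-- **Reduction theorem, finite-sum form, all parameter vectors** (closure over degenerate parameters): if the
test function `h_𝐩` depends continuously on `𝐩` and the within hypothesis `R_𝐩(g) ≥ 0` (all monotone `g ≥ 0`)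
holds for every NON-DEGENERATE `𝐩` (all coordinates in `(0,1)`; then the regeneration weight is automatically
positive), then `cov_D(f, h_w) ≥ 0` for EVERY `w ∈ [0,1]^{Sym2 V}` and every monotone `f` (`q ≥ 1`): both sides are
continuous in `𝐩` and the non-degenerate vectors are dense.  BHK's standing assumption is `0 < p_e < 1`;
parameters `0`/`1` are deleted/contracted edges.
[cite: VandenbergHaggstromKahn2005, §2.1 p. 9 ("we assume that 0 < p_e < 1"), pp. 10–13 — corollary, derived here] -/
theorem rcCovD_nonneg_of_withinD_nonneg_of_forall_nondegenerate (hq : 1 ≤ q) {D : Set (Set (Sym2 V))}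
    (hD : ∀ ω, ω ∈ D ↔ ∀ s ∈ S, ∀ t ∈ T, ¬ (openGraph ω).Reachable s t)
    (h : (Sym2 V → unitInterval) → Set (Sym2 V) → ℝ) (hcont : ∀ C, Continuous fun p => h p C)
    (hR : ∀ p : Sym2 V → unitInterval, (∀ e, 0 < p e ∧ p e < 1) →
      ∀ g : Set (Sym2 V) → ℝ, Monotone g → (∀ A, 0 ≤ g A) → 0 ≤ rcWithinD p q S T D g (h p))
    (w : Sym2 V → unitInterval) {f : Set (Sym2 V) → ℝ} (hf : Monotone f) :
    0 ≤ rcCovD w q S D f (h w) := by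
  have hq0 : 0 < q := one_pos.trans_le hq
  refine Literature.Probability.LatticeModels.weights_le_of_forall_pos_lt_one (f := fun _ => (0 : ℝ))
    continuous_const (continuous_rcCovD S hq0 D f hcont) (fun p hp => ?_) w
  have hp1 : ∀ e : Sym2 V, ¬ e.IsDiag → (∃ v ∈ e, v ∈ T) → (p e : ℝ) < 1 := fun e _ _ => by
    exact_mod_cast (hp e).2
  exact rcCovD_nonneg_of_withinD_nonneg S T hq hD (regenWeight_pos_of_lt_one T hp1) (h p) (hR p hp) hf

end Sums

end BHK2006

/-! ### Measure-level statements for `rcMeasureW w q ∅`, one source vertex `s`, target set `X` -/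

section Measure

variable {V : Type*} [Fintype V]

open scoped Classical
open BHK2006 DecisionTree

omit [Fintype V] in
/-- `D = {s ↮ X}` in the two-set form. [folklore] -/
private theorem mem_D_iff_rc (s : V) (X : Set V) (ω : BondConfig V) :
    ω ∈ {ω : BondConfig V | ∀ x ∈ X, ¬ (openGraph ω).Reachable s x} ↔
      ∀ s' ∈ ({s} : Set V), ∀ t ∈ X, ¬ (openGraph ω).Reachable s' t := by
  simp only [Set.mem_setOf_eq, Set.mem_singleton_iff, forall_eq]

/-- `∫_D ψ(C_s) dφ` as a finite sum against the point masses (`q > 0`). [cite: VandenbergHaggstromKahn2005, §2.1 eq. (11) (p. 9)] -/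
private theorem rc_setIntegral_D_eq_sum (w : Sym2 V → unitInterval) {q : ℝ} (hq : 0 < q) (s : V)
    (D : Set (BondConfig V)) (ψ : Set (Sym2 V) → ℝ) :
    ∫ ω in D, ψ (openEdgeCluster ω s) ∂(rcMeasureW w q ∅) =
      ∑ ω, rcMass w q ω * (ψ (setCl ω {s}) * ind D ω) := by
  rw [setIntegral_rcMeasureW_eq_sum w hq]
  refine Finset.sum_congr rfl fun ω _ => ?_
  rw [setCl_singleton]

/-- **The world expectation is `E[· | C_X]`**: the expectation of `φ(C_s)` under the random-cluster measure with
the pairs meeting the open vertex cluster of `X` in `ω` deleted (parameter `0`, same `q`) is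
`rcCondS w q {s} X φ (C_X ω)` (Lemma 2.3: given `C_X`, the configuration off `C̄_X` is `φ_{G − C̄_X, q}`).
[cite: VandenbergHaggstromKahn2005, §2.1 Lemmas 2.3–2.4 (p. 10)] -/
theorem BHK2006.integral_rcWorld_eq_rcCondS (w : Sym2 V → unitInterval) {q : ℝ} (hq : 0 < q) (s : V)
    (X : Set V) (φ : Set (Sym2 V) → ℝ) (ω : BondConfig V) :
    ∫ η, φ (openEdgeCluster η s)
        ∂(rcMeasureW (delW w {e | ∃ v ∈ e, ∃ x ∈ X, (openGraph ω).Reachable x v}) q ∅) =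
      rcCondS w q {s} X φ (setCl ω X) := by
  rw [integral_rcMeasureW_eq_sum _ hq, rcCondS, barOf_setCl_eq]
  refine Finset.sum_congr rfl fun η _ => ?_
  rw [setCl_singleton]

/-- **Reduction theorem for `φ_{𝐩,q}`, `q ≥ 1`, measure form.**  Random-cluster measure `φ = rcMeasureW w q ∅` on a
finite vertex type, a vertex `s`, a vertex set `X` such that every non-loop pair meeting `X` has `w e < 1`,
`D = {s ↮ X}`, `C_s` the open edge cluster of `s`, `A_X(ω)` the pairs meeting the open vertex cluster of `X`,
`φ^ω = rcMeasureW (delW w A_X(ω)) q ∅` (the random-cluster measure on `G − C̄_X(ω)`, same `q`: by Lemma 2.3 the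
conditional law, given the cluster of `X`, of the configuration off it), and ANY `h : Set (Sym2 V) → ℝ`.  If for every
monotone nonnegative `g`
`0 ≤ ∫_D ( E_{φ^ω}[(g h)(C_s)] − E_{φ^ω}[g(C_s)] · E_{φ^ω}[h(C_s)] ) dφ(ω)`
("the conditional covariance of `g(C_s)` and `h(C_s)` given the cluster of `X`, averaged over `D`, is `≥ 0`"), then
for every monotone `f`
`0 ≤ φ(D) ∫_D f(C_s) h(C_s) dφ − (∫_D f(C_s) dφ)(∫_D h(C_s) dφ)`.
At `q = 1` (`rcMeasureW_one`) this is the tree's `BHK2006_clusterConditionalCov_nonneg_of_within` (there the world is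
written with the fresh configuration `η ∖ A_X(ω)` of the product measure; here with the deleted parameters).
[cite: VandenbergHaggstromKahn2005, §2.1 pp. 10–13 (Lemmas 2.3–2.4, the chain, display (16), Remark 2.8) — corollary, derived here] -/
theorem BHK2006_clusterConditionalCov_nonneg_of_within_rc (w : Sym2 V → unitInterval) {q : ℝ} (hq : 1 ≤ q)
    (s : V) (X : Set V) (hX : ∀ e : Sym2 V, ¬ e.IsDiag → (∃ v ∈ e, v ∈ X) → (w e : ℝ) < 1)
    (h : Set (Sym2 V) → ℝ)
    (hR : ∀ g : Set (Sym2 V) → ℝ, Monotone g → (∀ C, 0 ≤ g C) →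
      0 ≤ ∫ ω in {ω : BondConfig V | ∀ x ∈ X, ¬ (openGraph ω).Reachable s x},
        ((∫ η, g (openEdgeCluster η s) * h (openEdgeCluster η s)
            ∂(rcMeasureW (delW w {e | ∃ v ∈ e, ∃ x ∈ X, (openGraph ω).Reachable x v}) q ∅)) -
          (∫ η, g (openEdgeCluster η s)
            ∂(rcMeasureW (delW w {e | ∃ v ∈ e, ∃ x ∈ X, (openGraph ω).Reachable x v}) q ∅)) *
          (∫ η, h (openEdgeCluster η s)
            ∂(rcMeasureW (delW w {e | ∃ v ∈ e, ∃ x ∈ X, (openGraph ω).Reachable x v}) q ∅)))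
        ∂(rcMeasureW w q ∅))
    (f : Set (Sym2 V) → ℝ) (hf : Monotone f) :
    0 ≤ (rcMeasureW w q ∅).real {ω : BondConfig V | ∀ x ∈ X, ¬ (openGraph ω).Reachable s x} *
        (∫ ω in {ω : BondConfig V | ∀ x ∈ X, ¬ (openGraph ω).Reachable s x},
          f (openEdgeCluster ω s) * h (openEdgeCluster ω s) ∂(rcMeasureW w q ∅)) -
      (∫ ω in {ω : BondConfig V | ∀ x ∈ X, ¬ (openGraph ω).Reachable s x},
          f (openEdgeCluster ω s) ∂(rcMeasureW w q ∅)) *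
        (∫ ω in {ω : BondConfig V | ∀ x ∈ X, ¬ (openGraph ω).Reachable s x},
          h (openEdgeCluster ω s) ∂(rcMeasureW w q ∅)) := by
  classical
  have hq0 : 0 < q := one_pos.trans_le hq
  set D : Set (BondConfig V) := {ω | ∀ x ∈ X, ¬ (openGraph ω).Reachable s x} with hDdef
  have hD : ∀ ω, ω ∈ D ↔ ∀ s' ∈ ({s} : Set V), ∀ t ∈ X, ¬ (openGraph ω).Reachable s' t :=
    mem_D_iff_rc s X
  -- positivity of the regeneration weight
  have hε : 0 < regenWeight (fun e => (w e : ℝ)) X := by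
    rw [regenWeight_eq_prod w X]
    refine Finset.prod_pos fun e he => ?_
    obtain ⟨hd, hv⟩ := (Finset.mem_filter.1 he).2
    exact sub_pos.2 (hX e hd hv)
  -- the conclusion in sum form
  have hcov : (rcMeasureW w q ∅).real D *
      (∫ ω in D, f (openEdgeCluster ω s) * h (openEdgeCluster ω s) ∂(rcMeasureW w q ∅)) -
      (∫ ω in D, f (openEdgeCluster ω s) ∂(rcMeasureW w q ∅)) *
        (∫ ω in D, h (openEdgeCluster ω s) ∂(rcMeasureW w q ∅)) = rcCovD w q {s} D f h := by
    rw [rcCovD, rcMeasureW_real_eq_sum_rcMass w hq0 D,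
      rc_setIntegral_D_eq_sum w hq0 s D (fun C => f C * h C), rc_setIntegral_D_eq_sum w hq0 s D f,
      rc_setIntegral_D_eq_sum w hq0 s D h]
  rw [hcov]
  refine rcCovD_nonneg_of_withinD_nonneg {s} X hq hD hε h (fun g hg hg0 => ?_) hf
  -- the hypothesis in sum form
  have hwithin : ∫ ω in D,
      ((∫ η, g (openEdgeCluster η s) * h (openEdgeCluster η s)
          ∂(rcMeasureW (delW w {e | ∃ v ∈ e, ∃ x ∈ X, (openGraph ω).Reachable x v}) q ∅)) -
        (∫ η, g (openEdgeCluster η s)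
          ∂(rcMeasureW (delW w {e | ∃ v ∈ e, ∃ x ∈ X, (openGraph ω).Reachable x v}) q ∅)) *
        (∫ η, h (openEdgeCluster η s)
          ∂(rcMeasureW (delW w {e | ∃ v ∈ e, ∃ x ∈ X, (openGraph ω).Reachable x v}) q ∅)))
      ∂(rcMeasureW w q ∅) = rcWithinD w q {s} X D g h := by
    rw [rcWithinD, setIntegral_rcMeasureW_eq_sum w hq0]
    refine Finset.sum_congr rfl fun ω _ => ?_
    rw [rcCondCov, integral_rcWorld_eq_rcCondS w hq0 s X (fun A => g A * h A) ω,
      integral_rcWorld_eq_rcCondS w hq0 s X g ω, integral_rcWorld_eq_rcCondS w hq0 s X h ω]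
  rw [← hwithin]
  exact hR g hg hg0

/-- **Reduction theorem for `φ_{𝐩,q}`, all parameter vectors** (closure over degenerate parameters).  Let the test
function `h_𝐩 : Set (Sym2 V) → ℝ` depend continuously on `𝐩 ∈ [0,1]^{Sym2 V}`.  If the averaged conditional covariance
hypothesis of `BHK2006_clusterConditionalCov_nonneg_of_within_rc` holds (with `h_𝐩`) for every NON-DEGENERATE `𝐩`
(all `𝐩 e ∈ (0,1)`), then the conclusion holds (with `h_w`) for EVERY `w : Sym2 V → [0,1]`: both sides are continuous
in the parameters (`BHK2006.continuous_rcMass`) and the non-degenerate parameter vectors are dense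
(`Literature.Probability.LatticeModels.weights_le_of_forall_pos_lt_one`).  BHK's standing assumption is
`0 < p_e < 1`; parameters `0`/`1` are deleted/contracted edges.
[cite: VandenbergHaggstromKahn2005, §2.1 p. 9 ("we assume that 0 < p_e < 1"), pp. 10–13 — corollary, derived here; Grimmett2006, §4.5 proof of Thm. (4.58) (continuity in `p`)] -/
theorem BHK2006_clusterConditionalCov_nonneg_of_within_rc_of_forall_nondegenerate
    (w : Sym2 V → unitInterval) {q : ℝ} (hq : 1 ≤ q) (s : V) (X : Set V)
    (h : (Sym2 V → unitInterval) → Set (Sym2 V) → ℝ) (hcont : ∀ C, Continuous fun p => h p C)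
    (hR : ∀ p : Sym2 V → unitInterval, (∀ e, 0 < p e ∧ p e < 1) →
      ∀ g : Set (Sym2 V) → ℝ, Monotone g → (∀ C, 0 ≤ g C) →
      0 ≤ ∫ ω in {ω : BondConfig V | ∀ x ∈ X, ¬ (openGraph ω).Reachable s x},
        ((∫ η, g (openEdgeCluster η s) * h p (openEdgeCluster η s)
            ∂(rcMeasureW (delW p {e | ∃ v ∈ e, ∃ x ∈ X, (openGraph ω).Reachable x v}) q ∅)) -
          (∫ η, g (openEdgeCluster η s)
            ∂(rcMeasureW (delW p {e | ∃ v ∈ e, ∃ x ∈ X, (openGraph ω).Reachable x v}) q ∅)) *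
          (∫ η, h p (openEdgeCluster η s)
            ∂(rcMeasureW (delW p {e | ∃ v ∈ e, ∃ x ∈ X, (openGraph ω).Reachable x v}) q ∅)))
        ∂(rcMeasureW p q ∅))
    (f : Set (Sym2 V) → ℝ) (hf : Monotone f) :
    0 ≤ (rcMeasureW w q ∅).real {ω : BondConfig V | ∀ x ∈ X, ¬ (openGraph ω).Reachable s x} *
        (∫ ω in {ω : BondConfig V | ∀ x ∈ X, ¬ (openGraph ω).Reachable s x},
          f (openEdgeCluster ω s) * h w (openEdgeCluster ω s) ∂(rcMeasureW w q ∅)) -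
      (∫ ω in {ω : BondConfig V | ∀ x ∈ X, ¬ (openGraph ω).Reachable s x},
          f (openEdgeCluster ω s) ∂(rcMeasureW w q ∅)) *
        (∫ ω in {ω : BondConfig V | ∀ x ∈ X, ¬ (openGraph ω).Reachable s x},
          h w (openEdgeCluster ω s) ∂(rcMeasureW w q ∅)) := by
  classical
  have hq0 : 0 < q := one_pos.trans_le hq
  set D : Set (BondConfig V) := {ω | ∀ x ∈ X, ¬ (openGraph ω).Reachable s x} with hDdef
  -- the conclusion as a function of the parameters, in sum form
  set G : (Sym2 V → unitInterval) → ℝ := fun p => rcCovD p q {s} D f (h p) with hG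
  have hGeq : ∀ p : Sym2 V → unitInterval, (rcMeasureW p q ∅).real D *
      (∫ ω in D, f (openEdgeCluster ω s) * h p (openEdgeCluster ω s) ∂(rcMeasureW p q ∅)) -
      (∫ ω in D, f (openEdgeCluster ω s) ∂(rcMeasureW p q ∅)) *
        (∫ ω in D, h p (openEdgeCluster ω s) ∂(rcMeasureW p q ∅)) = G p := fun p => by
    show _ = rcCovD p q {s} D f (h p)
    rw [rcCovD, rcMeasureW_real_eq_sum_rcMass p hq0 D,
      rc_setIntegral_D_eq_sum p hq0 s D (fun C => f C * h p C), rc_setIntegral_D_eq_sum p hq0 s D f,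
      rc_setIntegral_D_eq_sum p hq0 s D (h p)]
  have hGc : Continuous G := by
    simp only [hG, rcCovD]
    refine Continuous.sub (Continuous.mul ?_ ?_) (Continuous.mul ?_ ?_)
    · exact continuous_finsetSum _ fun ω _ => (continuous_rcMass hq0 ω).mul continuous_const
    · exact continuous_finsetSum _ fun ω _ => (continuous_rcMass hq0 ω).mul
        ((continuous_const.mul (hcont _)).mul continuous_const)
    · exact continuous_finsetSum _ fun ω _ => (continuous_rcMass hq0 ω).mul continuous_const
    · exact continuous_finsetSum _ fun ω _ => (continuous_rcMass hq0 ω).mul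
        ((hcont _).mul continuous_const)
  rw [hGeq w]
  refine Literature.Probability.LatticeModels.weights_le_of_forall_pos_lt_one (f := fun _ => (0 : ℝ))
    continuous_const hGc (fun p hp => ?_) w
  rw [← hGeq p]
  have hX : ∀ e : Sym2 V, ¬ e.IsDiag → (∃ v ∈ e, v ∈ X) → (p e : ℝ) < 1 := fun e _ _ => by
    have h1 : p e < 1 := (hp e).2
    exact_mod_cast h1
  exact BHK2006_clusterConditionalCov_nonneg_of_within_rc p hq s X hX (h p) (hR p hp) f hf

end Measure

/-! ### Marker tests: bookkeeping for `h = a·1{s ↔ z} − b·1{s ↔ y}` and `h = Σ_u c(u)·1{s ↔ u}` under any finite measure -/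

section MarkerBookkeeping

variable {V : Type*} [Fintype V]

open scoped Classical
open BHK2006 DecisionTree

/-- `∫_D F · 1_A = ∫_{D ∩ A} F`. [folklore] -/
private theorem setIntegral_mul_indicator_one_rc (μ : Measure (BondConfig V)) (D A : Set (BondConfig V))
    (F : BondConfig V → ℝ) :
    ∫ ω in D, F ω * A.indicator 1 ω ∂μ = ∫ ω in D ∩ A, F ω ∂μ := by
  have hA : MeasurableSet A := MeasurableSet.of_discrete
  have e : (fun ω => F ω * A.indicator (1 : BondConfig V → ℝ) ω) = A.indicator F := by
    funext ω
    by_cases hω : ω ∈ A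
    · rw [Set.indicator_of_mem hω, Set.indicator_of_mem hω, Pi.one_apply, mul_one]
    · rw [Set.indicator_of_notMem hω, Set.indicator_of_notMem hω, mul_zero]
  rw [e, setIntegral_indicator hA]

/-- `∫ F · 1_A = ∫_A F`. [folklore] -/
private theorem integral_mul_indicator_one_rc (μ : Measure (BondConfig V)) (A : Set (BondConfig V))
    (F : BondConfig V → ℝ) :
    ∫ ω, F ω * A.indicator 1 ω ∂μ = ∫ ω in A, F ω ∂μ := by
  have h := setIntegral_mul_indicator_one_rc μ Set.univ A F
  rwa [Measure.restrict_univ, Set.univ_inter] at h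

/-- Multi-marker split: `∫_D F · (Σ_u c(u) 1{s↔u}) = Σ_u c(u) ∫_{D ∩ {s↔u}} F` (finite measure). [folklore] -/
private theorem multiMarker_setIntegral_split (μ : Measure (BondConfig V)) [IsFiniteMeasure μ]
    (D : Set (BondConfig V)) (s : V) (T : Finset V) (c : V → ℝ) (F : BondConfig V → ℝ) :
    ∫ ω in D, F ω * (fun C : Set (Sym2 V) =>
        ∑ u ∈ T, c u * (if (u = s ∨ ∃ e ∈ C, u ∈ e) then (1 : ℝ) else 0)) (openEdgeCluster ω s) ∂μ =
      ∑ u ∈ T, c u * ∫ ω in D ∩ openConn s u, F ω ∂μ := by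
  have e1 : (fun ω => F ω * (fun C : Set (Sym2 V) =>
      ∑ u ∈ T, c u * (if (u = s ∨ ∃ e ∈ C, u ∈ e) then (1 : ℝ) else 0)) (openEdgeCluster ω s)) =
      fun ω => ∑ u ∈ T, c u * (F ω * (openConn s u : Set (BondConfig V)).indicator 1 ω) := by
    funext ω
    simp only [ite_mem_openEdgeCluster_eq_indicator, Finset.mul_sum]
    exact Finset.sum_congr rfl fun u _ => by ring
  rw [e1, integral_finsetSum _ fun u _ => Integrable.of_finite]
  exact Finset.sum_congr rfl fun u _ => by
    rw [integral_const_mul, setIntegral_mul_indicator_one_rc]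

/-- Multi-marker mass: `∫_D Σ_u c(u) 1{s↔u} = Σ_u c(u) μ(D ∩ {s↔u})` (finite measure). [folklore] -/
private theorem multiMarker_setIntegral_mass (μ : Measure (BondConfig V)) [IsFiniteMeasure μ]
    (D : Set (BondConfig V)) (s : V) (T : Finset V) (c : V → ℝ) :
    ∫ ω in D, (fun C : Set (Sym2 V) =>
        ∑ u ∈ T, c u * (if (u = s ∨ ∃ e ∈ C, u ∈ e) then (1 : ℝ) else 0)) (openEdgeCluster ω s) ∂μ =
      ∑ u ∈ T, c u * μ.real (D ∩ openConn s u) := by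
  have h2 := multiMarker_setIntegral_split μ D s T c (fun _ => (1 : ℝ))
  simp only [one_mul] at h2
  rw [h2]
  exact Finset.sum_congr rfl fun u _ => by rw [setIntegral_const, smul_eq_mul, mul_one]

/-- Multi-marker covariance bookkeeping, world side: under any finite measure `ν`,
`E_ν[g(C_s) H(C_s)] − E_ν[g(C_s)] E_ν[H(C_s)] = Σ_u c(u)·[∫_{s↔u} g(C_s) dν − (∫ g(C_s) dν) ν(s↔u)]` for
`H = Σ_u c(u) 1{s↔u}`. [folklore] -/
private theorem multiMarker_world_eq (ν : Measure (BondConfig V)) [IsFiniteMeasure ν] (s : V) (T : Finset V)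
    (c : V → ℝ) (g : Set (Sym2 V) → ℝ) :
    (∫ η, g (openEdgeCluster η s) * (fun C : Set (Sym2 V) =>
        ∑ u ∈ T, c u * (if (u = s ∨ ∃ e ∈ C, u ∈ e) then (1 : ℝ) else 0)) (openEdgeCluster η s) ∂ν) -
      (∫ η, g (openEdgeCluster η s) ∂ν) *
      (∫ η, (fun C : Set (Sym2 V) =>
        ∑ u ∈ T, c u * (if (u = s ∨ ∃ e ∈ C, u ∈ e) then (1 : ℝ) else 0)) (openEdgeCluster η s) ∂ν) =
    ∑ u ∈ T, c u * ((∫ η in (openConn s u : Set (BondConfig V)), g (openEdgeCluster η s) ∂ν) -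
      (∫ η, g (openEdgeCluster η s) ∂ν) * ν.real (openConn s u : Set (BondConfig V))) := by
  have h1 := multiMarker_setIntegral_split ν Set.univ s T c (fun η => g (openEdgeCluster η s))
  have h2 := multiMarker_setIntegral_mass ν Set.univ s T c
  simp only [Measure.restrict_univ, Set.univ_inter] at h1 h2
  rw [h1, h2, Finset.mul_sum, ← Finset.sum_sub_distrib]
  exact Finset.sum_congr rfl fun u _ => by ring

/-- Multi-marker covariance bookkeeping, conclusion side: under any finite measure `μ`,
`μ(D)∫_D fH − (∫_D f)(∫_D H) = Σ_u c(u)·[μ(D)∫_{D∩{s↔u}} f − (∫_D f) μ(D∩{s↔u})]`. [folklore] -/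
private theorem multiMarker_conclusion_eq_rc (μ : Measure (BondConfig V)) [IsFiniteMeasure μ]
    (D : Set (BondConfig V)) (s : V) (T : Finset V) (c : V → ℝ) (f : Set (Sym2 V) → ℝ) :
    μ.real D * (∫ ω in D, f (openEdgeCluster ω s) * (fun C : Set (Sym2 V) =>
        ∑ u ∈ T, c u * (if (u = s ∨ ∃ e ∈ C, u ∈ e) then (1 : ℝ) else 0)) (openEdgeCluster ω s) ∂μ) -
      (∫ ω in D, f (openEdgeCluster ω s) ∂μ) *
        (∫ ω in D, (fun C : Set (Sym2 V) =>
          ∑ u ∈ T, c u * (if (u = s ∨ ∃ e ∈ C, u ∈ e) then (1 : ℝ) else 0)) (openEdgeCluster ω s) ∂μ) =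
    ∑ u ∈ T, c u * (μ.real D * (∫ ω in D ∩ openConn s u, f (openEdgeCluster ω s) ∂μ) -
      (∫ ω in D, f (openEdgeCluster ω s) ∂μ) * μ.real (D ∩ openConn s u)) := by
  rw [multiMarker_setIntegral_split μ D s T c (fun ω => f (openEdgeCluster ω s)),
    multiMarker_setIntegral_mass μ D s T c, Finset.mul_sum, Finset.mul_sum, ← Finset.sum_sub_distrib]
  exact Finset.sum_congr rfl fun u _ => by ring

/-- Two-marker split: `∫_D F · (a 1{s↔z} − b 1{s↔y}) = a ∫_{D ∩ {s↔z}} F − b ∫_{D ∩ {s↔y}} F`. [folklore] -/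
private theorem twoMarker_setIntegral_split (μ : Measure (BondConfig V)) [IsFiniteMeasure μ]
    (D : Set (BondConfig V)) (s y z : V) (a b : ℝ) (F : BondConfig V → ℝ) :
    ∫ ω in D, F ω * (fun C : Set (Sym2 V) => a * (if (z = s ∨ ∃ e ∈ C, z ∈ e) then (1 : ℝ) else 0) -
        b * (if (y = s ∨ ∃ e ∈ C, y ∈ e) then (1 : ℝ) else 0)) (openEdgeCluster ω s) ∂μ =
      a * (∫ ω in D ∩ openConn s z, F ω ∂μ) - b * (∫ ω in D ∩ openConn s y, F ω ∂μ) := by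
  have e1 : (fun ω => F ω * (fun C : Set (Sym2 V) => a * (if (z = s ∨ ∃ e ∈ C, z ∈ e) then (1 : ℝ) else 0) -
      b * (if (y = s ∨ ∃ e ∈ C, y ∈ e) then (1 : ℝ) else 0)) (openEdgeCluster ω s)) = fun ω =>
      a * (F ω * (openConn s z : Set (BondConfig V)).indicator 1 ω) -
        b * (F ω * (openConn s y : Set (BondConfig V)).indicator 1 ω) := by
    funext ω
    simp only [ite_mem_openEdgeCluster_eq_indicator]
    ring
  rw [e1, integral_sub (Integrable.of_finite) (Integrable.of_finite), integral_const_mul,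
    integral_const_mul, setIntegral_mul_indicator_one_rc, setIntegral_mul_indicator_one_rc]

/-- Two-marker mass: `∫_D (a 1{s↔z} − b 1{s↔y}) = a μ(D ∩ {s↔z}) − b μ(D ∩ {s↔y})`. [folklore] -/
private theorem twoMarker_setIntegral_mass (μ : Measure (BondConfig V)) [IsFiniteMeasure μ]
    (D : Set (BondConfig V)) (s y z : V) (a b : ℝ) :
    ∫ ω in D, (fun C : Set (Sym2 V) => a * (if (z = s ∨ ∃ e ∈ C, z ∈ e) then (1 : ℝ) else 0) -
        b * (if (y = s ∨ ∃ e ∈ C, y ∈ e) then (1 : ℝ) else 0)) (openEdgeCluster ω s) ∂μ =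
      a * μ.real (D ∩ openConn s z) - b * μ.real (D ∩ openConn s y) := by
  have h2 := twoMarker_setIntegral_split μ D s y z a b (fun _ => (1 : ℝ))
  simp only [one_mul] at h2
  rw [h2, setIntegral_const, setIntegral_const, smul_eq_mul, smul_eq_mul, mul_one, mul_one]

/-- Two-marker covariance bookkeeping, world side (any finite measure `ν`): with `H = a 1{s↔z} − b 1{s↔y}`,
`E_ν[gH] − E_ν[g]E_ν[H] = a·[∫_{s↔z} g dν − (∫ g dν) ν(s↔z)] − b·[the same with y]`. [folklore] -/
private theorem twoMarker_world_eq (ν : Measure (BondConfig V)) [IsFiniteMeasure ν] (s y z : V) (a b : ℝ)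
    (g : Set (Sym2 V) → ℝ) :
    (∫ η, g (openEdgeCluster η s) * (fun C : Set (Sym2 V) => a * (if (z = s ∨ ∃ e ∈ C, z ∈ e) then (1 : ℝ) else 0) -
        b * (if (y = s ∨ ∃ e ∈ C, y ∈ e) then (1 : ℝ) else 0)) (openEdgeCluster η s) ∂ν) -
      (∫ η, g (openEdgeCluster η s) ∂ν) *
      (∫ η, (fun C : Set (Sym2 V) => a * (if (z = s ∨ ∃ e ∈ C, z ∈ e) then (1 : ℝ) else 0) -
        b * (if (y = s ∨ ∃ e ∈ C, y ∈ e) then (1 : ℝ) else 0)) (openEdgeCluster η s) ∂ν) =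
    a * ((∫ η in (openConn s z : Set (BondConfig V)), g (openEdgeCluster η s) ∂ν) -
        (∫ η, g (openEdgeCluster η s) ∂ν) * ν.real (openConn s z : Set (BondConfig V))) -
      b * ((∫ η in (openConn s y : Set (BondConfig V)), g (openEdgeCluster η s) ∂ν) -
        (∫ η, g (openEdgeCluster η s) ∂ν) * ν.real (openConn s y : Set (BondConfig V))) := by
  have h1 := twoMarker_setIntegral_split ν Set.univ s y z a b (fun η => g (openEdgeCluster η s))
  have h2 := twoMarker_setIntegral_mass ν Set.univ s y z a b
  simp only [Measure.restrict_univ, Set.univ_inter] at h1 h2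
  rw [h1, h2]
  ring

/-- Two-marker covariance bookkeeping, conclusion side (any finite measure `μ`): with `H = a 1{s↔z} − b 1{s↔y}`,
`μ(D)∫_D fH − (∫_D f)(∫_D H) = a·[μ(D)∫_{D∩{s↔z}} f − (∫_D f) μ(D∩{s↔z})] − b·[the same with y]`. [folklore] -/
private theorem twoMarker_conclusion_eq_rc (μ : Measure (BondConfig V)) [IsFiniteMeasure μ]
    (D : Set (BondConfig V)) (s y z : V) (a b : ℝ) (f : Set (Sym2 V) → ℝ) :
    μ.real D * (∫ ω in D, f (openEdgeCluster ω s) *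
        (fun C : Set (Sym2 V) => a * (if (z = s ∨ ∃ e ∈ C, z ∈ e) then (1 : ℝ) else 0) -
          b * (if (y = s ∨ ∃ e ∈ C, y ∈ e) then (1 : ℝ) else 0)) (openEdgeCluster ω s) ∂μ) -
      (∫ ω in D, f (openEdgeCluster ω s) ∂μ) *
        (∫ ω in D, (fun C : Set (Sym2 V) => a * (if (z = s ∨ ∃ e ∈ C, z ∈ e) then (1 : ℝ) else 0) -
          b * (if (y = s ∨ ∃ e ∈ C, y ∈ e) then (1 : ℝ) else 0)) (openEdgeCluster ω s) ∂μ) =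
    a * (μ.real D * (∫ ω in D ∩ openConn s z, f (openEdgeCluster ω s) ∂μ) -
        (∫ ω in D, f (openEdgeCluster ω s) ∂μ) * μ.real (D ∩ openConn s z)) -
      b * (μ.real D * (∫ ω in D ∩ openConn s y, f (openEdgeCluster ω s) ∂μ) -
        (∫ ω in D, f (openEdgeCluster ω s) ∂μ) * μ.real (D ∩ openConn s y)) := by
  rw [twoMarker_setIntegral_split μ D s y z a b (fun ω => f (openEdgeCluster ω s)),
    twoMarker_setIntegral_mass μ D s y z a b]
  ring

end MarkerBookkeeping

/-! ### The two-marker form: `h = a·1{s ↔ z} − b·1{s ↔ y}` (the shape of the marker-dominance lemma) -/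

section TwoMarkers

variable {V : Type*} [Fintype V]

open scoped Classical
open BHK2006 DecisionTree

/-- **Reduction theorem for `φ_{𝐩,q}`, two-marker form (the shape of the marker-dominance lemma MDL(X)_FK).**
Random-cluster measure `φ = rcMeasureW w q ∅`, `q ≥ 1`, on a finite vertex type; a source `s`, an avoided vertex
set `X` with `w e < 1` on the non-loop pairs meeting `X`, two further vertices `y, z`, constants `a, b ∈ ℝ`;
`D = {s ↮ X}`, `C_s` the open edge cluster of `s`, and for each `ω` the WORLD
`φ^ω = rcMeasureW (delW w A_X(ω)) q ∅` — the random-cluster measure with the pairs meeting the open vertex cluster of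
`X` deleted (parameter `0`) and the same `q` (Lemma 2.3).  If for every monotone nonnegative `g`
`0 ≤ ∫_D ( a·[∫_{s↔z} g(C_s) dφ^ω − (∫ g(C_s) dφ^ω) φ^ω(s↔z)] − b·[the same with y] ) dφ(ω)`
(the conditional covariances of `g(C_s)` with `a·1{s↔z} − b·1{s↔y}` given the cluster of `X`, averaged over `D`),
then for every monotone `f`
`b·[φ(D) ∫_{D ∩ {s↔y}} f(C_s) − (∫_D f(C_s)) φ(D ∩ {s↔y})] ≤ a·[φ(D) ∫_{D ∩ {s↔z}} f(C_s) − (∫_D f(C_s)) φ(D ∩ {s↔z})]`.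
This is `BHK2006_clusterConditionalCov_nonneg_of_within_rc` for the test function `h = a·1{s↔z} − b·1{s↔y}`; at
`q = 1` it is the tree's `BHK2006_twoMarkerCov_le_of_within`.
[cite: VandenbergHaggstromKahn2005, §2.1 pp. 10–13 (the chain) and Lemmas 2.3–2.4 (p. 10) — corollary, derived here] -/
theorem BHK2006_twoMarkerCov_le_of_within_rc (w : Sym2 V → unitInterval) {q : ℝ} (hq : 1 ≤ q) (s : V)
    (X : Set V) (y z : V) (a b : ℝ) (hX : ∀ e : Sym2 V, ¬ e.IsDiag → (∃ v ∈ e, v ∈ X) → (w e : ℝ) < 1)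
    (hR : ∀ g : Set (Sym2 V) → ℝ, Monotone g → (∀ C, 0 ≤ g C) →
      0 ≤ ∫ ω in {ω : BondConfig V | ∀ x ∈ X, ¬ (openGraph ω).Reachable s x},
        (a * ((∫ η in (openConn s z : Set (BondConfig V)), g (openEdgeCluster η s)
                ∂(rcMeasureW (delW w {e | ∃ v ∈ e, ∃ x ∈ X, (openGraph ω).Reachable x v}) q ∅)) -
              (∫ η, g (openEdgeCluster η s)
                ∂(rcMeasureW (delW w {e | ∃ v ∈ e, ∃ x ∈ X, (openGraph ω).Reachable x v}) q ∅)) *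
              (rcMeasureW (delW w {e | ∃ v ∈ e, ∃ x ∈ X, (openGraph ω).Reachable x v}) q ∅).real
                (openConn s z : Set (BondConfig V))) -
          b * ((∫ η in (openConn s y : Set (BondConfig V)), g (openEdgeCluster η s)
                ∂(rcMeasureW (delW w {e | ∃ v ∈ e, ∃ x ∈ X, (openGraph ω).Reachable x v}) q ∅)) -
              (∫ η, g (openEdgeCluster η s)
                ∂(rcMeasureW (delW w {e | ∃ v ∈ e, ∃ x ∈ X, (openGraph ω).Reachable x v}) q ∅)) *
              (rcMeasureW (delW w {e | ∃ v ∈ e, ∃ x ∈ X, (openGraph ω).Reachable x v}) q ∅).real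
                (openConn s y : Set (BondConfig V))))
        ∂(rcMeasureW w q ∅))
    (f : Set (Sym2 V) → ℝ) (hf : Monotone f) :
    b * ((rcMeasureW w q ∅).real {ω : BondConfig V | ∀ x ∈ X, ¬ (openGraph ω).Reachable s x} *
          (∫ ω in {ω : BondConfig V | ∀ x ∈ X, ¬ (openGraph ω).Reachable s x} ∩ openConn s y,
            f (openEdgeCluster ω s) ∂(rcMeasureW w q ∅)) -
        (∫ ω in {ω : BondConfig V | ∀ x ∈ X, ¬ (openGraph ω).Reachable s x},
            f (openEdgeCluster ω s) ∂(rcMeasureW w q ∅)) *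
          (rcMeasureW w q ∅).real
            ({ω : BondConfig V | ∀ x ∈ X, ¬ (openGraph ω).Reachable s x} ∩ openConn s y)) ≤
    a * ((rcMeasureW w q ∅).real {ω : BondConfig V | ∀ x ∈ X, ¬ (openGraph ω).Reachable s x} *
          (∫ ω in {ω : BondConfig V | ∀ x ∈ X, ¬ (openGraph ω).Reachable s x} ∩ openConn s z,
            f (openEdgeCluster ω s) ∂(rcMeasureW w q ∅)) -
        (∫ ω in {ω : BondConfig V | ∀ x ∈ X, ¬ (openGraph ω).Reachable s x},
            f (openEdgeCluster ω s) ∂(rcMeasureW w q ∅)) *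
          (rcMeasureW w q ∅).real
            ({ω : BondConfig V | ∀ x ∈ X, ¬ (openGraph ω).Reachable s x} ∩ openConn s z)) := by
  have hq0 : 0 < q := one_pos.trans_le hq
  haveI := isProbabilityMeasure_rcMeasureW w hq0 ∅
  have main := BHK2006_clusterConditionalCov_nonneg_of_within_rc w hq s X hX
    (fun C : Set (Sym2 V) => a * (if (z = s ∨ ∃ e ∈ C, z ∈ e) then (1 : ℝ) else 0) -
      b * (if (y = s ∨ ∃ e ∈ C, y ∈ e) then (1 : ℝ) else 0))
    (fun g hg hg0 => by
      have e : ∀ ω : BondConfig V,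
          (∫ η, g (openEdgeCluster η s) * (fun C : Set (Sym2 V) =>
              a * (if (z = s ∨ ∃ e ∈ C, z ∈ e) then (1 : ℝ) else 0) -
                b * (if (y = s ∨ ∃ e ∈ C, y ∈ e) then (1 : ℝ) else 0)) (openEdgeCluster η s)
              ∂(rcMeasureW (delW w {e | ∃ v ∈ e, ∃ x ∈ X, (openGraph ω).Reachable x v}) q ∅)) -
            (∫ η, g (openEdgeCluster η s)
              ∂(rcMeasureW (delW w {e | ∃ v ∈ e, ∃ x ∈ X, (openGraph ω).Reachable x v}) q ∅)) *
            (∫ η, (fun C : Set (Sym2 V) =>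
              a * (if (z = s ∨ ∃ e ∈ C, z ∈ e) then (1 : ℝ) else 0) -
                b * (if (y = s ∨ ∃ e ∈ C, y ∈ e) then (1 : ℝ) else 0)) (openEdgeCluster η s)
              ∂(rcMeasureW (delW w {e | ∃ v ∈ e, ∃ x ∈ X, (openGraph ω).Reachable x v}) q ∅)) =
          a * ((∫ η in (openConn s z : Set (BondConfig V)), g (openEdgeCluster η s)
                ∂(rcMeasureW (delW w {e | ∃ v ∈ e, ∃ x ∈ X, (openGraph ω).Reachable x v}) q ∅)) -
              (∫ η, g (openEdgeCluster η s)
                ∂(rcMeasureW (delW w {e | ∃ v ∈ e, ∃ x ∈ X, (openGraph ω).Reachable x v}) q ∅)) *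
              (rcMeasureW (delW w {e | ∃ v ∈ e, ∃ x ∈ X, (openGraph ω).Reachable x v}) q ∅).real
                (openConn s z : Set (BondConfig V))) -
          b * ((∫ η in (openConn s y : Set (BondConfig V)), g (openEdgeCluster η s)
                ∂(rcMeasureW (delW w {e | ∃ v ∈ e, ∃ x ∈ X, (openGraph ω).Reachable x v}) q ∅)) -
              (∫ η, g (openEdgeCluster η s)
                ∂(rcMeasureW (delW w {e | ∃ v ∈ e, ∃ x ∈ X, (openGraph ω).Reachable x v}) q ∅)) *
              (rcMeasureW (delW w {e | ∃ v ∈ e, ∃ x ∈ X, (openGraph ω).Reachable x v}) q ∅).real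
                (openConn s y : Set (BondConfig V))) := fun ω => by
        haveI := isProbabilityMeasure_rcMeasureW
          (delW w {e | ∃ v ∈ e, ∃ x ∈ X, (openGraph ω).Reachable x v}) hq0 ∅
        exact twoMarker_world_eq _ s y z a b g
      rw [funext e]
      exact hR g hg hg0) f hf
  rw [twoMarker_conclusion_eq_rc (rcMeasureW w q ∅) _ s y z a b f] at main
  linarith

/-- **Reduction theorem for `φ_{𝐩,q}`, two-marker form, all parameter vectors** (closure over degenerate
parameters): the coefficients `a_𝐩, b_𝐩` may depend continuously on the parameters, the hypothesis is only
required for non-degenerate `𝐩` (all `𝐩 e ∈ (0,1)`), and the conclusion holds for every `w : Sym2 V → [0,1]`.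
At `q = 1` this is the tree's `BHK2006_twoMarkerCov_le_of_within_of_forall_nondegenerate`.
[cite: VandenbergHaggstromKahn2005, §2.1 p. 9 and pp. 10–13 — corollary, derived here; Grimmett2006, §4.5 proof of Thm. (4.58) (continuity in `p`)] -/
theorem BHK2006_twoMarkerCov_le_of_within_rc_of_forall_nondegenerate (w : Sym2 V → unitInterval) {q : ℝ}
    (hq : 1 ≤ q) (s : V) (X : Set V) (y z : V) (a b : (Sym2 V → unitInterval) → ℝ) (ha : Continuous a)
    (hb : Continuous b)
    (hR : ∀ p : Sym2 V → unitInterval, (∀ e, 0 < p e ∧ p e < 1) →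
      ∀ g : Set (Sym2 V) → ℝ, Monotone g → (∀ C, 0 ≤ g C) →
      0 ≤ ∫ ω in {ω : BondConfig V | ∀ x ∈ X, ¬ (openGraph ω).Reachable s x},
        (a p * ((∫ η in (openConn s z : Set (BondConfig V)), g (openEdgeCluster η s)
                ∂(rcMeasureW (delW p {e | ∃ v ∈ e, ∃ x ∈ X, (openGraph ω).Reachable x v}) q ∅)) -
              (∫ η, g (openEdgeCluster η s)
                ∂(rcMeasureW (delW p {e | ∃ v ∈ e, ∃ x ∈ X, (openGraph ω).Reachable x v}) q ∅)) *
              (rcMeasureW (delW p {e | ∃ v ∈ e, ∃ x ∈ X, (openGraph ω).Reachable x v}) q ∅).real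
                (openConn s z : Set (BondConfig V))) -
          b p * ((∫ η in (openConn s y : Set (BondConfig V)), g (openEdgeCluster η s)
                ∂(rcMeasureW (delW p {e | ∃ v ∈ e, ∃ x ∈ X, (openGraph ω).Reachable x v}) q ∅)) -
              (∫ η, g (openEdgeCluster η s)
                ∂(rcMeasureW (delW p {e | ∃ v ∈ e, ∃ x ∈ X, (openGraph ω).Reachable x v}) q ∅)) *
              (rcMeasureW (delW p {e | ∃ v ∈ e, ∃ x ∈ X, (openGraph ω).Reachable x v}) q ∅).real
                (openConn s y : Set (BondConfig V))))
        ∂(rcMeasureW p q ∅))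
    (f : Set (Sym2 V) → ℝ) (hf : Monotone f) :
    b w * ((rcMeasureW w q ∅).real {ω : BondConfig V | ∀ x ∈ X, ¬ (openGraph ω).Reachable s x} *
          (∫ ω in {ω : BondConfig V | ∀ x ∈ X, ¬ (openGraph ω).Reachable s x} ∩ openConn s y,
            f (openEdgeCluster ω s) ∂(rcMeasureW w q ∅)) -
        (∫ ω in {ω : BondConfig V | ∀ x ∈ X, ¬ (openGraph ω).Reachable s x},
            f (openEdgeCluster ω s) ∂(rcMeasureW w q ∅)) *
          (rcMeasureW w q ∅).real
            ({ω : BondConfig V | ∀ x ∈ X, ¬ (openGraph ω).Reachable s x} ∩ openConn s y)) ≤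
    a w * ((rcMeasureW w q ∅).real {ω : BondConfig V | ∀ x ∈ X, ¬ (openGraph ω).Reachable s x} *
          (∫ ω in {ω : BondConfig V | ∀ x ∈ X, ¬ (openGraph ω).Reachable s x} ∩ openConn s z,
            f (openEdgeCluster ω s) ∂(rcMeasureW w q ∅)) -
        (∫ ω in {ω : BondConfig V | ∀ x ∈ X, ¬ (openGraph ω).Reachable s x},
            f (openEdgeCluster ω s) ∂(rcMeasureW w q ∅)) *
          (rcMeasureW w q ∅).real
            ({ω : BondConfig V | ∀ x ∈ X, ¬ (openGraph ω).Reachable s x} ∩ openConn s z)) := by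
  have hq0 : 0 < q := one_pos.trans_le hq
  haveI := isProbabilityMeasure_rcMeasureW w hq0 ∅
  have hcont : ∀ C : Set (Sym2 V), Continuous fun p : Sym2 V → unitInterval =>
      (fun (p : Sym2 V → unitInterval) (C : Set (Sym2 V)) =>
        a p * (if (z = s ∨ ∃ e ∈ C, z ∈ e) then (1 : ℝ) else 0) -
          b p * (if (y = s ∨ ∃ e ∈ C, y ∈ e) then (1 : ℝ) else 0)) p C := fun C =>
    (ha.mul continuous_const).sub (hb.mul continuous_const)
  have main := BHK2006_clusterConditionalCov_nonneg_of_within_rc_of_forall_nondegenerate w hq s X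
    (fun (p : Sym2 V → unitInterval) (C : Set (Sym2 V)) =>
      a p * (if (z = s ∨ ∃ e ∈ C, z ∈ e) then (1 : ℝ) else 0) -
        b p * (if (y = s ∨ ∃ e ∈ C, y ∈ e) then (1 : ℝ) else 0)) hcont
    (fun p hp g hg hg0 => by
      have e : ∀ ω : BondConfig V,
          (∫ η, g (openEdgeCluster η s) * (fun C : Set (Sym2 V) =>
              a p * (if (z = s ∨ ∃ e ∈ C, z ∈ e) then (1 : ℝ) else 0) -
                b p * (if (y = s ∨ ∃ e ∈ C, y ∈ e) then (1 : ℝ) else 0)) (openEdgeCluster η s)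
              ∂(rcMeasureW (delW p {e | ∃ v ∈ e, ∃ x ∈ X, (openGraph ω).Reachable x v}) q ∅)) -
            (∫ η, g (openEdgeCluster η s)
              ∂(rcMeasureW (delW p {e | ∃ v ∈ e, ∃ x ∈ X, (openGraph ω).Reachable x v}) q ∅)) *
            (∫ η, (fun C : Set (Sym2 V) =>
              a p * (if (z = s ∨ ∃ e ∈ C, z ∈ e) then (1 : ℝ) else 0) -
                b p * (if (y = s ∨ ∃ e ∈ C, y ∈ e) then (1 : ℝ) else 0)) (openEdgeCluster η s)
              ∂(rcMeasureW (delW p {e | ∃ v ∈ e, ∃ x ∈ X, (openGraph ω).Reachable x v}) q ∅)) =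
          a p * ((∫ η in (openConn s z : Set (BondConfig V)), g (openEdgeCluster η s)
                ∂(rcMeasureW (delW p {e | ∃ v ∈ e, ∃ x ∈ X, (openGraph ω).Reachable x v}) q ∅)) -
              (∫ η, g (openEdgeCluster η s)
                ∂(rcMeasureW (delW p {e | ∃ v ∈ e, ∃ x ∈ X, (openGraph ω).Reachable x v}) q ∅)) *
              (rcMeasureW (delW p {e | ∃ v ∈ e, ∃ x ∈ X, (openGraph ω).Reachable x v}) q ∅).real
                (openConn s z : Set (BondConfig V))) -
          b p * ((∫ η in (openConn s y : Set (BondConfig V)), g (openEdgeCluster η s)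
                ∂(rcMeasureW (delW p {e | ∃ v ∈ e, ∃ x ∈ X, (openGraph ω).Reachable x v}) q ∅)) -
              (∫ η, g (openEdgeCluster η s)
                ∂(rcMeasureW (delW p {e | ∃ v ∈ e, ∃ x ∈ X, (openGraph ω).Reachable x v}) q ∅)) *
              (rcMeasureW (delW p {e | ∃ v ∈ e, ∃ x ∈ X, (openGraph ω).Reachable x v}) q ∅).real
                (openConn s y : Set (BondConfig V))) := fun ω => by
        haveI := isProbabilityMeasure_rcMeasureW
          (delW p {e | ∃ v ∈ e, ∃ x ∈ X, (openGraph ω).Reachable x v}) hq0 ∅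
        exact twoMarker_world_eq _ s y z (a p) (b p) g
      rw [funext e]
      exact hR p hp g hg hg0) f hf
  rw [twoMarker_conclusion_eq_rc (rcMeasureW w q ∅) _ s y z (a w) (b w) f] at main
  linarith

end TwoMarkers

/-! ### The multi-marker form: `h = Σ_{u ∈ T} c(u)·1{s ↔ u}` (the shape of "Lemma T" of the conditioned slack hierarchy) -/

section MultiMarkers

variable {V : Type*} [Fintype V]

open scoped Classical
open BHK2006 DecisionTree

/-- **Reduction theorem for `φ_{𝐩,q}`, multi-marker form, FIXED parameters.**  Random-cluster measure
`φ = rcMeasureW w q ∅`, `q ≥ 1`, on a finite vertex type; a source `s`, an avoided set `X` with `w e < 1` on the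
non-loop pairs meeting `X` (in particular any non-degenerate `w`), a finite set `T` of markers with constant
coefficients `c(u)`; `D = {s ↮ X}`; for each `ω` the world `φ^ω = rcMeasureW (delW w A_X(ω)) q ∅` (pairs meeting the
open vertex cluster of `X` deleted, same `q`).  If for every monotone nonnegative `g`
`0 ≤ ∫_D Σ_{u∈T} c(u)·[∫_{s↔u} g(C_s) dφ^ω − (∫ g(C_s) dφ^ω) φ^ω(s↔u)] dφ(ω)`
(the conditional covariance of `g(C_s)` with `Σ_u c(u) 1{s↔u}` given the cluster of `X`, averaged over `D`), then
for every monotone `f`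
`0 ≤ Σ_{u∈T} c(u)·[φ(D) ∫_{D ∩ {s↔u}} f(C_s) − (∫_D f(C_s)) φ(D ∩ {s↔u})]`.
(`BHK2006_clusterConditionalCov_nonneg_of_within_rc` for `h = Σ_u c(u)·1{s↔u}`; at `q = 1` the tree's
`BHK2006_multiMarkerCov_nonneg_of_within` — the form used INSIDE an induction at fixed parameters.)
[cite: VandenbergHaggstromKahn2005, §2.1 pp. 10–13 (the chain) and Lemmas 2.3–2.4 (p. 10) — corollary, derived here] -/
theorem BHK2006_multiMarkerCov_nonneg_of_within_rc (w : Sym2 V → unitInterval) {q : ℝ} (hq : 1 ≤ q) (s : V)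
    (X : Set V) (hX : ∀ e : Sym2 V, ¬ e.IsDiag → (∃ v ∈ e, v ∈ X) → (w e : ℝ) < 1) (T : Finset V)
    (c : V → ℝ)
    (hR : ∀ g : Set (Sym2 V) → ℝ, Monotone g → (∀ C, 0 ≤ g C) →
      0 ≤ ∫ ω in {ω : BondConfig V | ∀ x ∈ X, ¬ (openGraph ω).Reachable s x},
        (∑ u ∈ T, c u * ((∫ η in (openConn s u : Set (BondConfig V)), g (openEdgeCluster η s)
                ∂(rcMeasureW (delW w {e | ∃ v ∈ e, ∃ x ∈ X, (openGraph ω).Reachable x v}) q ∅)) -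
              (∫ η, g (openEdgeCluster η s)
                ∂(rcMeasureW (delW w {e | ∃ v ∈ e, ∃ x ∈ X, (openGraph ω).Reachable x v}) q ∅)) *
              (rcMeasureW (delW w {e | ∃ v ∈ e, ∃ x ∈ X, (openGraph ω).Reachable x v}) q ∅).real
                (openConn s u : Set (BondConfig V))))
        ∂(rcMeasureW w q ∅))
    (f : Set (Sym2 V) → ℝ) (hf : Monotone f) :
    0 ≤ ∑ u ∈ T, c u *
        ((rcMeasureW w q ∅).real {ω : BondConfig V | ∀ x ∈ X, ¬ (openGraph ω).Reachable s x} *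
            (∫ ω in {ω : BondConfig V | ∀ x ∈ X, ¬ (openGraph ω).Reachable s x} ∩ openConn s u,
              f (openEdgeCluster ω s) ∂(rcMeasureW w q ∅)) -
          (∫ ω in {ω : BondConfig V | ∀ x ∈ X, ¬ (openGraph ω).Reachable s x},
              f (openEdgeCluster ω s) ∂(rcMeasureW w q ∅)) *
            (rcMeasureW w q ∅).real
              ({ω : BondConfig V | ∀ x ∈ X, ¬ (openGraph ω).Reachable s x} ∩ openConn s u)) := by
  have hq0 : 0 < q := one_pos.trans_le hq
  haveI := isProbabilityMeasure_rcMeasureW w hq0 ∅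
  have main := BHK2006_clusterConditionalCov_nonneg_of_within_rc w hq s X hX
    (fun C : Set (Sym2 V) => ∑ u ∈ T, c u * (if (u = s ∨ ∃ e ∈ C, u ∈ e) then (1 : ℝ) else 0))
    (fun g hg hg0 => by
      have e : ∀ ω : BondConfig V,
          (∫ η, g (openEdgeCluster η s) * (fun C : Set (Sym2 V) =>
              ∑ u ∈ T, c u * (if (u = s ∨ ∃ e ∈ C, u ∈ e) then (1 : ℝ) else 0)) (openEdgeCluster η s)
              ∂(rcMeasureW (delW w {e | ∃ v ∈ e, ∃ x ∈ X, (openGraph ω).Reachable x v}) q ∅)) -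
            (∫ η, g (openEdgeCluster η s)
              ∂(rcMeasureW (delW w {e | ∃ v ∈ e, ∃ x ∈ X, (openGraph ω).Reachable x v}) q ∅)) *
            (∫ η, (fun C : Set (Sym2 V) =>
              ∑ u ∈ T, c u * (if (u = s ∨ ∃ e ∈ C, u ∈ e) then (1 : ℝ) else 0)) (openEdgeCluster η s)
              ∂(rcMeasureW (delW w {e | ∃ v ∈ e, ∃ x ∈ X, (openGraph ω).Reachable x v}) q ∅)) =
          ∑ u ∈ T, c u * ((∫ η in (openConn s u : Set (BondConfig V)), g (openEdgeCluster η s)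
                ∂(rcMeasureW (delW w {e | ∃ v ∈ e, ∃ x ∈ X, (openGraph ω).Reachable x v}) q ∅)) -
              (∫ η, g (openEdgeCluster η s)
                ∂(rcMeasureW (delW w {e | ∃ v ∈ e, ∃ x ∈ X, (openGraph ω).Reachable x v}) q ∅)) *
              (rcMeasureW (delW w {e | ∃ v ∈ e, ∃ x ∈ X, (openGraph ω).Reachable x v}) q ∅).real
                (openConn s u : Set (BondConfig V))) := fun ω => by
        haveI := isProbabilityMeasure_rcMeasureW
          (delW w {e | ∃ v ∈ e, ∃ x ∈ X, (openGraph ω).Reachable x v}) hq0 ∅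
        exact multiMarker_world_eq _ s T c g
      rw [funext e]
      exact hR g hg hg0) f hf
  rw [multiMarker_conclusion_eq_rc (rcMeasureW w q ∅) _ s T c f] at main
  exact main

/-- **Reduction theorem for `φ_{𝐩,q}`, multi-marker form, all parameter vectors** (the shape of the conditioned
slack hierarchy; closure over degenerate parameters): coefficients `Λ_𝐩(u)` depending continuously on the
parameters, hypothesis for every NON-DEGENERATE `𝐩` and every monotone nonnegative `g`, conclusion for EVERY `w`
and every monotone `f`.  At `q = 1` this is the tree's `BHK2006_multiMarkerCov_nonneg_of_within_of_forall_nondegenerate`.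
[cite: VandenbergHaggstromKahn2005, §2.1 p. 9 and pp. 10–13 — corollary, derived here; Grimmett2006, §4.5 proof of Thm. (4.58) (continuity in `p`)] -/
theorem BHK2006_multiMarkerCov_nonneg_of_within_rc_of_forall_nondegenerate (w : Sym2 V → unitInterval)
    {q : ℝ} (hq : 1 ≤ q) (s : V) (X : Set V) (T : Finset V) (Λ : (Sym2 V → unitInterval) → V → ℝ)
    (hΛ : ∀ u, Continuous fun p => Λ p u)
    (hR : ∀ p : Sym2 V → unitInterval, (∀ e, 0 < p e ∧ p e < 1) →
      ∀ g : Set (Sym2 V) → ℝ, Monotone g → (∀ C, 0 ≤ g C) →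
      0 ≤ ∫ ω in {ω : BondConfig V | ∀ x ∈ X, ¬ (openGraph ω).Reachable s x},
        (∑ u ∈ T, Λ p u * ((∫ η in (openConn s u : Set (BondConfig V)), g (openEdgeCluster η s)
                ∂(rcMeasureW (delW p {e | ∃ v ∈ e, ∃ x ∈ X, (openGraph ω).Reachable x v}) q ∅)) -
              (∫ η, g (openEdgeCluster η s)
                ∂(rcMeasureW (delW p {e | ∃ v ∈ e, ∃ x ∈ X, (openGraph ω).Reachable x v}) q ∅)) *
              (rcMeasureW (delW p {e | ∃ v ∈ e, ∃ x ∈ X, (openGraph ω).Reachable x v}) q ∅).real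
                (openConn s u : Set (BondConfig V))))
        ∂(rcMeasureW p q ∅))
    (f : Set (Sym2 V) → ℝ) (hf : Monotone f) :
    0 ≤ ∑ u ∈ T, Λ w u *
        ((rcMeasureW w q ∅).real {ω : BondConfig V | ∀ x ∈ X, ¬ (openGraph ω).Reachable s x} *
            (∫ ω in {ω : BondConfig V | ∀ x ∈ X, ¬ (openGraph ω).Reachable s x} ∩ openConn s u,
              f (openEdgeCluster ω s) ∂(rcMeasureW w q ∅)) -
          (∫ ω in {ω : BondConfig V | ∀ x ∈ X, ¬ (openGraph ω).Reachable s x},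
              f (openEdgeCluster ω s) ∂(rcMeasureW w q ∅)) *
            (rcMeasureW w q ∅).real
              ({ω : BondConfig V | ∀ x ∈ X, ¬ (openGraph ω).Reachable s x} ∩ openConn s u)) := by
  have hq0 : 0 < q := one_pos.trans_le hq
  haveI := isProbabilityMeasure_rcMeasureW w hq0 ∅
  have hcont : ∀ C : Set (Sym2 V), Continuous fun p : Sym2 V → unitInterval =>
      (fun (p : Sym2 V → unitInterval) (C : Set (Sym2 V)) =>
        ∑ u ∈ T, Λ p u * (if (u = s ∨ ∃ e ∈ C, u ∈ e) then (1 : ℝ) else 0)) p C := fun C =>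
    continuous_finsetSum _ fun u _ => (hΛ u).mul continuous_const
  have main := BHK2006_clusterConditionalCov_nonneg_of_within_rc_of_forall_nondegenerate w hq s X
    (fun (p : Sym2 V → unitInterval) (C : Set (Sym2 V)) =>
      ∑ u ∈ T, Λ p u * (if (u = s ∨ ∃ e ∈ C, u ∈ e) then (1 : ℝ) else 0)) hcont
    (fun p hp g hg hg0 => by
      have e : ∀ ω : BondConfig V,
          (∫ η, g (openEdgeCluster η s) * (fun C : Set (Sym2 V) =>
              ∑ u ∈ T, Λ p u * (if (u = s ∨ ∃ e ∈ C, u ∈ e) then (1 : ℝ) else 0)) (openEdgeCluster η s)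
              ∂(rcMeasureW (delW p {e | ∃ v ∈ e, ∃ x ∈ X, (openGraph ω).Reachable x v}) q ∅)) -
            (∫ η, g (openEdgeCluster η s)
              ∂(rcMeasureW (delW p {e | ∃ v ∈ e, ∃ x ∈ X, (openGraph ω).Reachable x v}) q ∅)) *
            (∫ η, (fun C : Set (Sym2 V) =>
              ∑ u ∈ T, Λ p u * (if (u = s ∨ ∃ e ∈ C, u ∈ e) then (1 : ℝ) else 0)) (openEdgeCluster η s)
              ∂(rcMeasureW (delW p {e | ∃ v ∈ e, ∃ x ∈ X, (openGraph ω).Reachable x v}) q ∅)) =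
          ∑ u ∈ T, Λ p u * ((∫ η in (openConn s u : Set (BondConfig V)), g (openEdgeCluster η s)
                ∂(rcMeasureW (delW p {e | ∃ v ∈ e, ∃ x ∈ X, (openGraph ω).Reachable x v}) q ∅)) -
              (∫ η, g (openEdgeCluster η s)
                ∂(rcMeasureW (delW p {e | ∃ v ∈ e, ∃ x ∈ X, (openGraph ω).Reachable x v}) q ∅)) *
              (rcMeasureW (delW p {e | ∃ v ∈ e, ∃ x ∈ X, (openGraph ω).Reachable x v}) q ∅).real
                (openConn s u : Set (BondConfig V))) := fun ω => by
        haveI := isProbabilityMeasure_rcMeasureW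
          (delW p {e | ∃ v ∈ e, ∃ x ∈ X, (openGraph ω).Reachable x v}) hq0 ∅
        exact multiMarker_world_eq _ s T (Λ p) g
      rw [funext e]
      exact hR p hp g hg hg0) f hf
  rw [multiMarker_conclusion_eq_rc (rcMeasureW w q ∅) _ s T (Λ w) f] at main
  exact main

end MultiMarkers

end Literature.Probability.Percolation

end
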